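import Summits.CriticalPhenomena.PercolationContinuityZ3.Theorems.Transplant.SkelFrmBChoiceRootReadY
import Summits.CriticalPhenomena.PercolationContinuityZ3.Theorems.Transplant.SkelFrmBChoiceRootPairing
import Summits.CriticalPhenomena.PercolationContinuityZ3.Theorems.Transplant.SkelPhiCorridorKGYPaired
import Summits.CriticalPhenomena.PercolationContinuityZ3.Theorems.Transplant.SkelPhiNegReachReadBK
import Summits.CriticalPhenomena.PercolationContinuityZ3.Theorems.Transplant.SkelFrmBParamsCorrKGLenY
import HarnessLib

/-!
# N2 (frames-only node `SamePDropOfSkeletonFrm₁`, OPEN), (R) column, reading rows: **THE ROOT y′-CORRIDOR's FOOTPRINT ROW `hfoot₃`, PER REGION,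
# WITH NO READING HYPOTHESIS** — `KS.hfoot₃_Rk` (ruling (R-50): the one-box reading (R-Y) is infeasible under shear; read each region in its own
# drift-paired box)

For every region `r` of the root's y′-corridor (rows `kgYRows0_of … mk qxY (KS.WxYR …)`, run length `kgNYv0 mk qxY WxY`, origin
`c₂ = t + (X2R, Y2R)`), every vertex read there has `RootFootT (fcellsT … c) (1, true) (fineA … φ′ w)`: the region lies in a drift-paired box
`x ∈ X2R + k·v_L ± B`, `rows ∈ [k·sLo − Q⁻, k·sHi + Q⁺ + 1]` (`Skelφ.kgCorrSchedY_region_paired` + the `(X2R, Y2R)` shift `KS.runX_shift_mem_Icc`),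
whose along reading de-shears (`KS.pairing_bounds`: `m·hi₀ − min(…) ≤ m(X2R + B) + 2U(N+1)n_L + n_L(U·Q + U)`), and the exact-form criteria
`Skelφ.rdHi_zero_leK / rdLo_zero_geK / rdHi_one_leK / rdLo_one_geK` (SkelPhiNegReachReadBK, `hsc_Q`) give `|rd₀| ≤ 3r₀ − 1`,
`−5r₁ + 1 ≤ rd₁ ≤ 25r₁ − 1` from the crude uniform budgets `X2R + B ≤ (353 + 11kq)·n_L`, `Q ≤ (50 + 2kq)·sL`, `2U(N+1) ≤ 4kq·m`, `5 ≤ kq`.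
Hypotheses = the (R) slot floors and window caps of the second-axis wrapper (`hN hg hg2 hWxY hWx hqx20`) and `5 ≤ Kq` (node₂'s `Kmin = 200`).
NON-VACUITY (lead g11 standing order): geometry + arithmetic at the tuple; nothing assumed beyond the wrapper's own hypotheses.
builds on p205010 (kernel theorem, internal audit signed; external expert review pending) — nothing in this file uses p205010; NOTHING is claimed
about the open node `SamePDropOfSkeletonFrm₁`.
Lane `prim-bschramm`, seat `prim-bschramm-p3` (gen 18; N2 design owner, (R) column owner); helper file (`--supports stmt-CriticalPhenomena-4575 --as helper`).
[cite: KozmaNitzan2024, §4 p. 28 ((32) at the root), Lemma 12 (pp. 23–25)]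
-/

noncomputable section

open scoped Classical

namespace Summit.CriticalPhenomena.PercolationContinuityZ3.Theorems.Transplant

open MeasureTheory Literature.Probability.Percolation Literature.Probability.LatticeModels SimpleGraph KNCells KNLevels
open Literature.Probability.Percolation.KozmaNitzan.Cells (oth sgOf)
open SkelConc (Consts)
open Skelφ (rootFrame RootFootT TargetFootT shearUnit kgSL kgSLY kgZY₀ kgZY₁ kgM₁Y kgM₂Y kgWm₂Y kgWp₂Y kgE₁Y kgA₁Ym kgA₁Yp rdLo rdHi KGYRows)
open TwoAxis.Para (modulus)
open ChainPlanar (ScheduleNP)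

namespace PlanarSkeletonFrm

namespace NegB

open Neg

namespace KS

section ReadYk

variable (κ : Consts) {V : Type} [DecidableEq V] [Countable V] {G : SimpleGraph V} [G.LocallyFinite] (Φ : PlanarSkeletonFrm G) (t : V) (p : unitInterval)
  (D : Skelφ.StepI.DataNS V) (mk g f qxY WxY : ℕ) (c : Fin 2 → ℕ)

set_option maxHeartbeats 6400000 in
/-- **`hfoot₃` OF THE SECOND-AXIS (R) SKELETON, DISCHARGED PER REGION** (no reading hypothesis; see the module docstring).
[cite: KozmaNitzan2024, §4 p. 28 ((32) at the root)] -/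
theorem hfoot₃_Rk (hKq : 5 ≤ Neg.Kq κ) (hN : EqNumL κ Φ t p D g f) (hg : gFloorKG κ Φ t p D mk ≤ g) (hg2 : 40 * Neg.K κ * KS0.R'0 κ Φ t p D mk ≤ g)
    (hWxY : KS.Rs t D mk + 34 * nL κ Φ t p D g f + 29 * KS0.R'0 κ Φ t p D mk + 2 ≤ WxY) (hWx : WxY ≤ 100 * nL κ Φ t p D g f)
    (hqx20 : (qxY : ℤ) ≤ 20 * (kgSL (nL κ Φ t p D g f) (ℓL κ Φ t p D g f) (hL κ Φ t p D g f)))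
    {φ' : V → Site 2} {c₂ : V} (hX : φ' c₂ 0 - φ' t 0 = (((KS.X2R κ Φ t p D mk g f WxY) : ℕ) : ℤ)) (hY : φ' c₂ 1 - φ' t 1 = (KS.Y2R κ Φ t p D mk g f WxY)) :
    ∀ k ≤ (Skelφ.kgCorrSchedY (kgYRows0_of κ Φ t p D g f mk qxY (KS.WxYR κ Φ t p D mk g f WxY) hN hg).hn (kgYRows0_of κ Φ t p D g f mk qxY (KS.WxYR κ Φ t p D mk g f WxY) hN hg).hv (kgYRows0_of κ Φ t p D g f mk qxY (KS.WxYR κ Φ t p D mk g f WxY) hN hg).hlay ((kgYRows0_of κ Φ t p D g f mk qxY (KS.WxYR κ Φ t p D mk g f WxY) hN hg).kgYVals_ok₁ (kgNYv0 κ Φ t p D g f mk qxY WxY)) ((kgYRows0_of κ Φ t p D g f mk qxY (KS.WxYR κ Φ t p D mk g f WxY) hN hg).kgYVals_ok₂ (kgNYv0 κ Φ t p D g f mk qxY WxY)) ((kgYRows0_of κ Φ t p D g f mk qxY (KS.WxYR κ Φ t p D mk g f WxY) hN hg).kgYVals_split (kgNYv0 κ Φ t p D g f mk qxY WxY))).N,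 ∀ w : V, Skelφ.runX φ' c₂ (nL κ Φ t p D g f) (hL κ Φ t p D g f) 1 w ∈ (Skelφ.kgCorrSchedY (kgYRows0_of κ Φ t p D g f mk qxY (KS.WxYR κ Φ t p D mk g f WxY) hN hg).hn (kgYRows0_of κ Φ t p D g f mk qxY (KS.WxYR κ Φ t p D mk g f WxY) hN hg).hv (kgYRows0_of κ Φ t p D g f mk qxY (KS.WxYR κ Φ t p D mk g f WxY) hN hg).hlay ((kgYRows0_of κ Φ t p D g f mk qxY (KS.WxYR κ Φ t p D mk g f WxY) hN hg).kgYVals_ok₁ (kgNYv0 κ Φ t p D g f mk qxY WxY)) ((kgYRows0_of κ Φ t p D g f mk qxY (KS.WxYR κ Φ t p D mk g f WxY) hN hg).kgYVals_ok₂ (kgNYv0 κ Φ t p D g f mk qxY WxY)) ((kgYRows0_of κ Φ t p D g f mk qxY (KS.WxYR κ Φ t p D mk g f WxY) hN hg).kgYVals_split (kgNYv0 κ Φ t p D g f mk qxY WxY))).region k →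
      RootFootT (fcellsT κ Φ t p D g f c) (((1 : Fin 2), true) : MDir) (fineA κ Φ t p D g f φ' w) := by
  intro r hr w hw
  have H := kgYRows0_of κ Φ t p D g f mk qxY (KS.WxYR κ Φ t p D mk g f WxY) hN hg
  -- §a the tuple's arithmetic facts
  obtain ⟨hsc0, hsc1, hn1, hA0, hDp, hm, hc₀, hc₁, hkq, hr40⟩ := hsc_Q κ Φ t p D g f hN
  obtain ⟨hKR, hKs, h958, hR1, hK40, h8⟩ := valsQ_floor κ Φ t p D g f mk hN hg hg2
  have eR : ((KS0.R'0 κ Φ t p D mk : ℕ) : ℤ) = ((kgR κ Φ t p D mk : ℕ) : ℤ) := rfl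
  rw [eR] at hKR hKs hR1 h8
  have hKq' : (Neg.K κ : ℤ) = 40 * ((Neg.Kq κ : ℕ) : ℤ) := by exact_mod_cast Neg.K_eq κ
  have hkq5 : (5 : ℤ) ≤ ((Neg.Kq κ : ℕ) : ℤ) := by exact_mod_cast hKq
  have hkq0 : (0 : ℤ) ≤ ((Neg.Kq κ : ℕ) : ℤ) := by linarith only [hkq5]
  have hkq1 : (1 : ℤ) ≤ ((Neg.Kq κ : ℕ) : ℤ) := by linarith only [hkq5]
  have hR0 : (0 : ℤ) ≤ ((kgR κ Φ t p D mk : ℕ) : ℤ) := by positivity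
  have hKRq : 1600 * ((Neg.Kq κ : ℕ) : ℤ) * ((kgR κ Φ t p D mk : ℕ) : ℤ) + 1 ≤ (nL κ Φ t p D g f : ℤ) := by have h0 := hKR; rw [hKq'] at h0; linarith only [h0]
  have hKsq : 1600 * ((Neg.Kq κ : ℕ) : ℤ) * ((kgR κ Φ t p D mk : ℕ) : ℤ) ≤ (kgSL (nL κ Φ t p D g f) (ℓL κ Φ t p D g f) (hL κ Φ t p D g f)) + 1 := by have h0 := hKs; rw [hKq'] at h0; linarith only [h0]
  have hkR : ((kgR κ Φ t p D mk : ℕ) : ℤ) ≤ ((Neg.Kq κ : ℕ) : ℤ) * ((kgR κ Φ t p D mk : ℕ) : ℤ) := by have h0 := mul_le_mul_of_nonneg_right hkq1 hR0; linarith only [h0]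
  have hkR5 : 5 * ((kgR κ Φ t p D mk : ℕ) : ℤ) ≤ ((Neg.Kq κ : ℕ) : ℤ) * ((kgR κ Φ t p D mk : ℕ) : ℤ) := mul_le_mul_of_nonneg_right hkq5 hR0
  have hkqR : ((Neg.Kq κ : ℕ) : ℤ) ≤ ((Neg.Kq κ : ℕ) : ℤ) * ((kgR κ Φ t p D mk : ℕ) : ℤ) := by have h0 := mul_le_mul_of_nonneg_left hR1 hkq0; linarith only [h0]
  have hkqR0 : (0 : ℤ) ≤ ((Neg.Kq κ : ℕ) : ℤ) * ((kgR κ Φ t p D mk : ℕ) : ℤ) := by positivity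
  have hR1600 : (1600 : ℤ) * ((kgR κ Φ t p D mk : ℕ) : ℤ) ≤ (nL κ Φ t p D g f : ℤ) - 1 := by linarith only [hKRq, hkR]
  have hR1600' : (1600 : ℤ) * ((kgR κ Φ t p D mk : ℕ) : ℤ) ≤ (kgSL (nL κ Φ t p D g f) (ℓL κ Φ t p D g f) (hL κ Φ t p D g f)) + 1 := by linarith only [hKsq, hkR]
  have hn0 : (0 : ℤ) < (nL κ Φ t p D g f : ℤ) := by exact_mod_cast hn1
  have hU0 : (0 : ℤ) < (((shearUnit (nL κ Φ t p D g f) (hL κ Φ t p D g f) : ℕ)) : ℤ) := Skelφ.shearUnit_pos hn1 _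
  have hUn : (nL κ Φ t p D g f : ℤ) ≤ (((shearUnit (nL κ Φ t p D g f) (hL κ Φ t p D g f) : ℕ)) : ℤ) := by
    unfold Skelφ.shearUnit; push_cast; linarith only [abs_nonneg (hL κ Φ t p D g f)]
  -- the modulus against the row pitches
  have hmod := Skelφ.NegPrm.modulus_vβOf hn1 (hL κ Φ t p D g f) (ℓL κ Φ t p D g f) (vL κ Φ t p D g f)
  have em : (modulus (nL κ Φ t p D g f) (hL κ Φ t p D g f) (vL κ Φ t p D g f) (vβL κ Φ t p D g f)) = modulus (nL κ Φ t p D g f) (hL κ Φ t p D g f) (vL κ Φ t p D g f) (Skelφ.NegPrm.vβOf (nL κ Φ t p D g f) (hL κ Φ t p D g f) (ℓL κ Φ t p D g f) (vL κ Φ t p D g f)) := rfl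
  rw [← em] at hmod
  obtain ⟨hm1, hm2⟩ := hmod
  have eσ : (kgSL (nL κ Φ t p D g f) (ℓL κ Φ t p D g f) (hL κ Φ t p D g f)) = (((nL κ Φ t p D g f : ℤ) * ℓL κ Φ t p D g f - (shearUnit (nL κ Φ t p D g f) (hL κ Φ t p D g f) : ℕ) + 1) / (shearUnit (nL κ Φ t p D g f) (hL κ Φ t p D g f) : ℕ)) := rfl
  have hσU : (((shearUnit (nL κ Φ t p D g f) (hL κ Φ t p D g f) : ℕ)) : ℤ) * (kgSL (nL κ Φ t p D g f) (ℓL κ Φ t p D g f) (hL κ Φ t p D g f)) ≤ (nL κ Φ t p D g f : ℤ) * ℓL κ Φ t p D g f - (shearUnit (nL κ Φ t p D g f) (hL κ Φ t p D g f) : ℕ) + 1 := by rw [eσ]; exact Int.mul_ediv_self_le (ne_of_gt hU0)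
  have hσU' : (nL κ Φ t p D g f : ℤ) * ℓL κ Φ t p D g f - (shearUnit (nL κ Φ t p D g f) (hL κ Φ t p D g f) : ℕ) + 1 < (((shearUnit (nL κ Φ t p D g f) (hL κ Φ t p D g f) : ℕ)) : ℤ) * (kgSL (nL κ Φ t p D g f) (ℓL κ Φ t p D g f) (hL κ Φ t p D g f)) + (shearUnit (nL κ Φ t p D g f) (hL κ Φ t p D g f) : ℕ) := by rw [eσ]; exact Int.lt_mul_ediv_self_add hU0
  have hUσm : (((shearUnit (nL κ Φ t p D g f) (hL κ Φ t p D g f) : ℕ)) : ℤ) * (kgSL (nL κ Φ t p D g f) (ℓL κ Φ t p D g f) (hL κ Φ t p D g f)) ≤ (modulus (nL κ Φ t p D g f) (hL κ Φ t p D g f) (vL κ Φ t p D g f) (vβL κ Φ t p D g f)) + 1 := by linarith only [hσU, hm1, hUn]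
  have hmσ1 : (modulus (nL κ Φ t p D g f) (hL κ Φ t p D g f) (vL κ Φ t p D g f) (vβL κ Φ t p D g f)) - (((shearUnit (nL κ Φ t p D g f) (hL κ Φ t p D g f) : ℕ)) : ℤ) * (kgSL (nL κ Φ t p D g f) (ℓL κ Φ t p D g f) (hL κ Φ t p D g f)) ≤ 2 * (((shearUnit (nL κ Φ t p D g f) (hL κ Φ t p D g f) : ℕ)) : ℤ) := by linarith only [hm2, hσU']
  have hPU : (((shearUnit (nL κ Φ t p D g f) (hL κ Φ t p D g f) : ℕ)) : ℤ) * ((nL κ Φ t p D g f : ℤ) * ℓL κ Φ t p D g f / (shearUnit (nL κ Φ t p D g f) (hL κ Φ t p D g f) : ℕ)) ≤ (nL κ Φ t p D g f : ℤ) * ℓL κ Φ t p D g f := Int.mul_ediv_self_le (ne_of_gt hU0)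
  have hmσ3 : (((shearUnit (nL κ Φ t p D g f) (hL κ Φ t p D g f) : ℕ)) : ℤ) * ((nL κ Φ t p D g f : ℤ) * ℓL κ Φ t p D g f / (shearUnit (nL κ Φ t p D g f) (hL κ Φ t p D g f) : ℕ) + 1) - (modulus (nL κ Φ t p D g f) (hL κ Φ t p D g f) (vL κ Φ t p D g f) (vβL κ Φ t p D g f)) ≤ 2 * (((shearUnit (nL κ Φ t p D g f) (hL κ Φ t p D g f) : ℕ)) : ℤ) := by linarith only [hPU, hm1, hUn]
  have hm958 : (958 : ℤ) * (((shearUnit (nL κ Φ t p D g f) (hL κ Φ t p D g f) : ℕ)) : ℤ) ≤ (modulus (nL κ Φ t p D g f) (hL κ Φ t p D g f) (vL κ Φ t p D g f) (vβL κ Φ t p D g f)) + 1 := by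
    have h0 := mul_le_mul_of_nonneg_left h958 hU0.le; linarith only [h0, hUσm]
  have hU479 : (479 : ℤ) * (((shearUnit (nL κ Φ t p D g f) (hL κ Φ t p D g f) : ℕ)) : ℤ) ≤ (modulus (nL κ Φ t p D g f) (hL κ Φ t p D g f) (vL κ Φ t p D g f) (vβL κ Φ t p D g f)) := by linarith only [hm958, hm]
  have hσ0 : (0 : ℤ) ≤ (kgSL (nL κ Φ t p D g f) (ℓL κ Φ t p D g f) (hL κ Φ t p D g f)) := by linarith only [h958]
  have h00 : ((0 : ℕ) : ℤ) = 0 := Nat.cast_zero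
  -- §b the corridor's counts
  have hNle : ((kgNYv0 κ Φ t p D g f mk qxY WxY : ℕ) : ℤ) ≤ 21 * (Neg.K κ : ℤ) + 2 := by exact_mod_cast kgNYv0_le κ Φ t p D g f mk qxY WxY hN hg
  have hN0 : (0 : ℤ) ≤ ((kgNYv0 κ Φ t p D g f mk qxY WxY : ℕ) : ℤ) := by positivity
  have hNK : ((kgNYv0 κ Φ t p D g f mk qxY WxY : ℕ) : ℤ) + 1 ≤ 840 * ((Neg.Kq κ : ℕ) : ℤ) + 3 := by have h0 := hNle; rw [hKq'] at h0; linarith only [h0]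
  have hRv := H.hv
  have habs0 : (0 : ℤ) ≤ |vL κ Φ t p D g f| := abs_nonneg _
  obtain ⟨htn1, htn2⟩ := H.toNat_eq
  obtain ⟨-, hXW⟩ := X2R_add_WxYR κ Φ t p D mk g f WxY hWxY
  have eWC : ((kgWY κ Φ t p D g f WxY : ℕ) : ℤ) = 2 * (nL κ Φ t p D g f : ℤ) + WxY := by unfold kgWY; push_cast; ring
  have hX2lo : (WxY : ℤ) + 34 * (nL κ Φ t p D g f : ℤ) + 1 ≤ 2 * (((KS.X2R κ Φ t p D mk g f WxY) : ℕ) : ℤ) := by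
    have h0 : WxY + 34 * nL κ Φ t p D g f + 1 ≤ 2 * KS.X2R κ Φ t p D mk g f WxY := by unfold KS.X2R; omega
    exact_mod_cast h0
  have hW0 : (0 : ℤ) ≤ ((kgWY κ Φ t p D g f (KS.WxYR κ Φ t p D mk g f WxY) : ℕ) : ℤ) := by positivity
  have hX0 : (0 : ℤ) ≤ (((KS.X2R κ Φ t p D mk g f WxY) : ℕ) : ℤ) := by positivity
  have hWx' : (WxY : ℤ) ≤ 100 * (nL κ Φ t p D g f : ℤ) := by exact_mod_cast hWx
  have hXWn : (((KS.X2R κ Φ t p D mk g f WxY) : ℕ) : ℤ) + ((kgWY κ Φ t p D g f (KS.WxYR κ Φ t p D mk g f WxY) : ℕ) : ℤ) ≤ 102 * (nL κ Φ t p D g f : ℤ) := by linarith only [hXW, eWC, hWx']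
  have hW35 : ((kgWY κ Φ t p D g f (KS.WxYR κ Φ t p D mk g f WxY) : ℕ) : ℤ) ≤ 35 * (nL κ Φ t p D g f : ℤ) := by linarith only [hXW, eWC, hX2lo, hWx']
  have hNR0 : (0 : ℤ) ≤ (((kgNYv0 κ Φ t p D g f mk qxY WxY : ℕ) : ℤ) + 1) * ((kgR κ Φ t p D mk : ℕ) : ℤ) := by positivity
  have hN1 : (((kgNYv0 κ Φ t p D g f mk qxY WxY : ℕ) : ℤ) + 1) * ((kgR κ Φ t p D mk : ℕ) : ℤ) ≤ (840 * ((Neg.Kq κ : ℕ) : ℤ) + 3) * ((kgR κ Φ t p D mk : ℕ) : ℤ) := mul_le_mul_of_nonneg_right hNK hR0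
  have hNRn : (((kgNYv0 κ Φ t p D g f mk qxY WxY : ℕ) : ℤ) + 1) * ((kgR κ Φ t p D mk : ℕ) : ℤ) ≤ (nL κ Φ t p D g f : ℤ) - 1 := by linarith only [hN1, hKRq, hkR, hkqR0]
  have hNRσ : (((kgNYv0 κ Φ t p D g f mk qxY WxY : ℕ) : ℤ) + 1) * ((kgR κ Φ t p D mk : ℕ) : ℤ) ≤ ((Neg.Kq κ : ℕ) : ℤ) * (kgSL (nL κ Φ t p D g f) (ℓL κ Φ t p D g f) (hL κ Φ t p D g f)) := by
    have h2 : ((Neg.Kq κ : ℕ) : ℤ) * (1600 * ((Neg.Kq κ : ℕ) : ℤ) * ((kgR κ Φ t p D mk : ℕ) : ℤ) - 1) ≤ ((Neg.Kq κ : ℕ) : ℤ) * (kgSL (nL κ Φ t p D g f) (ℓL κ Φ t p D g f) (hL κ Φ t p D g f)) := mul_le_mul_of_nonneg_left (by linarith only [hKsq]) hkq0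
    have h3 : (0 : ℤ) ≤ 1600 * ((Neg.Kq κ : ℕ) : ℤ) * ((kgR κ Φ t p D mk : ℕ) : ℤ) - 843 * ((kgR κ Φ t p D mk : ℕ) : ℤ) - 1 := by linarith only [hkR, hR1]
    have h4 := mul_nonneg hkq0 h3
    linarith only [hN1, h2, h4, hkR]
  -- m₁ + 1 ≤ 412
  obtain ⟨hsp1, -⟩ := H.kgM₁Y_spec (kgNYv0 κ Φ t p D g f mk qxY WxY)
  obtain ⟨hd1a, hd1b⟩ := H.dec₁_pos
  have hd1pos : (0 : ℤ) < (Skelφ.kgDec₁Y (nL κ Φ t p D g f) (kgR κ Φ t p D mk) 0) := by push_cast at hd1a; linarith only [hd1a, hR0]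
  have eT1 : (Skelφ.kgT₁Y (vL κ Φ t p D g f) (kgR κ Φ t p D mk) (kgWY κ Φ t p D g f (KS.WxYR κ Φ t p D mk g f WxY)) (kgNYv0 κ Φ t p D g f mk qxY WxY)) = 2 * ((kgWY κ Φ t p D g f (KS.WxYR κ Φ t p D mk g f WxY) : ℕ) : ℤ) + 2 * (((kgNYv0 κ Φ t p D g f mk qxY WxY : ℕ) : ℤ) + 1) * ((kgR κ Φ t p D mk : ℕ) : ℤ) - 2 * |vL κ Φ t p D g f| := by unfold Skelφ.kgT₁Y; ring
  have hm1d : (((kgM₁Y (nL κ Φ t p D g f) (vL κ Φ t p D g f) (kgR κ Φ t p D mk) 0 (kgWY κ Φ t p D g f (KS.WxYR κ Φ t p D mk g f WxY)) (kgNYv0 κ Φ t p D g f mk qxY WxY) : ℕ) : ℤ) + 1) * (Skelφ.kgDec₁Y (nL κ Φ t p D g f) (kgR κ Φ t p D mk) 0) ≤ (Skelφ.kgT₁Y (vL κ Φ t p D g f) (kgR κ Φ t p D mk) (kgWY κ Φ t p D g f (KS.WxYR κ Φ t p D mk g f WxY)) (kgNYv0 κ Φ t p D g f mk qxY WxY))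 := by rw [hsp1]; exact Int.ediv_mul_le _ (ne_of_gt hd1pos)
  have hm10 : (0 : ℤ) ≤ ((kgM₁Y (nL κ Φ t p D g f) (vL κ Φ t p D g f) (kgR κ Φ t p D mk) 0 (kgWY κ Φ t p D g f (KS.WxYR κ Φ t p D mk g f WxY)) (kgNYv0 κ Φ t p D g f mk qxY WxY) : ℕ) : ℤ) + 1 := by positivity
  have hm1b : ((kgM₁Y (nL κ Φ t p D g f) (vL κ Φ t p D g f) (kgR κ Φ t p D mk) 0 (kgWY κ Φ t p D g f (KS.WxYR κ Φ t p D mk g f WxY)) (kgNYv0 κ Φ t p D g f mk qxY WxY) : ℕ) : ℤ) + 1 ≤ 412 := by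
    have h1 : (((kgM₁Y (nL κ Φ t p D g f) (vL κ Φ t p D g f) (kgR κ Φ t p D mk) 0 (kgWY κ Φ t p D g f (KS.WxYR κ Φ t p D mk g f WxY)) (kgNYv0 κ Φ t p D g f mk qxY WxY) : ℕ) : ℤ) + 1) * ((nL κ Φ t p D g f : ℤ) + 2) ≤ (((kgM₁Y (nL κ Φ t p D g f) (vL κ Φ t p D g f) (kgR κ Φ t p D mk) 0 (kgWY κ Φ t p D g f (KS.WxYR κ Φ t p D mk g f WxY)) (kgNYv0 κ Φ t p D g f mk qxY WxY) : ℕ) : ℤ) + 1) * (2 * (Skelφ.kgDec₁Y (nL κ Φ t p D g f) (kgR κ Φ t p D mk) 0)) :=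
      mul_le_mul_of_nonneg_left (by linarith only [hd1b]) hm10
    have h2 : (Skelφ.kgT₁Y (vL κ Φ t p D g f) (kgR κ Φ t p D mk) (kgWY κ Φ t p D g f (KS.WxYR κ Φ t p D mk g f WxY)) (kgNYv0 κ Φ t p D g f mk qxY WxY)) ≤ 206 * (nL κ Φ t p D g f : ℤ) := by rw [eT1]; linarith only [hW35, hNRn, habs0]
    have h3 : (((kgM₁Y (nL κ Φ t p D g f) (vL κ Φ t p D g f) (kgR κ Φ t p D mk) 0 (kgWY κ Φ t p D g f (KS.WxYR κ Φ t p D mk g f WxY)) (kgNYv0 κ Φ t p D g f mk qxY WxY) : ℕ) : ℤ) + 1) * (nL κ Φ t p D g f : ℤ) ≤ 412 * (nL κ Φ t p D g f : ℤ) := by linarith only [h1, hm1d, h2, hm10]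
    exact le_of_mul_le_mul_right h3 hn0
  have hm1R : (((kgM₁Y (nL κ Φ t p D g f) (vL κ Φ t p D g f) (kgR κ Φ t p D mk) 0 (kgWY κ Φ t p D g f (KS.WxYR κ Φ t p D mk g f WxY)) (kgNYv0 κ Φ t p D g f mk qxY WxY) : ℕ) : ℤ) + 1) * ((kgR κ Φ t p D mk : ℕ) : ℤ) ≤ 412 * ((kgR κ Φ t p D mk : ℕ) : ℤ) := mul_le_mul_of_nonneg_right hm1b hR0
  -- E₁ ≤ 5n
  obtain ⟨-, -, hE3⟩ := H.kgE₁Y_spec (kgNYv0 κ Φ t p D g f mk qxY WxY)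
  have hE5 : ((kgE₁Y (nL κ Φ t p D g f) (vL κ Φ t p D g f) (kgR κ Φ t p D mk) 0 (kgWY κ Φ t p D g f (KS.WxYR κ Φ t p D mk g f WxY)) (kgNYv0 κ Φ t p D g f mk qxY WxY) : ℕ) : ℤ) ≤ 5 * (nL κ Φ t p D g f : ℤ) := by
    have h0 : (Skelφ.kgDec₁Y (nL κ Φ t p D g f) (kgR κ Φ t p D mk) 0) ≤ (nL κ Φ t p D g f : ℤ) := by unfold Skelφ.kgDec₁Y; push_cast; linarith only [hR0]
    linarith only [hE3, h0, hRv]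
  -- the row-side sizes: q, P, L
  have hPσ : ((nL κ Φ t p D g f * ℓL κ Φ t p D g f / shearUnit (nL κ Φ t p D g f) (hL κ Φ t p D g f) : ℕ) : ℤ) ≤ (kgSL (nL κ Φ t p D g f) (ℓL κ Φ t p D g f) (hL κ Φ t p D g f)) + 1 := by rw [← kgSLY_eq_kgSL]; exact Skelφ.natDiv_le_kgSLY hn1 _ _
  have hP0 : (0 : ℤ) ≤ ((nL κ Φ t p D g f * ℓL κ Φ t p D g f / shearUnit (nL κ Φ t p D g f) (hL κ Φ t p D g f) : ℕ) : ℤ) := by positivity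
  have ePn : ((nL κ Φ t p D g f * ℓL κ Φ t p D g f / shearUnit (nL κ Φ t p D g f) (hL κ Φ t p D g f) : ℕ) : ℤ) = (nL κ Φ t p D g f : ℤ) * ℓL κ Φ t p D g f / (shearUnit (nL κ Φ t p D g f) (hL κ Φ t p D g f) : ℕ) := by push_cast; rfl
  have hsHi : ((nL κ Φ t p D g f : ℤ) * ℓL κ Φ t p D g f / (shearUnit (nL κ Φ t p D g f) (hL κ Φ t p D g f) : ℕ) + 1) ≤ (kgSL (nL κ Φ t p D g f) (ℓL κ Φ t p D g f) (hL κ Φ t p D g f)) + 2 := by rw [← ePn]; linarith only [hPσ]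
  have hsHi1 : (1 : ℤ) ≤ ((nL κ Φ t p D g f : ℤ) * ℓL κ Φ t p D g f / (shearUnit (nL κ Φ t p D g f) (hL κ Φ t p D g f) : ℕ) + 1) := by rw [← ePn]; linarith only [hP0]
  have eq_q : ((kgqY κ Φ t p D g f qxY : ℕ) : ℤ) = ((nL κ Φ t p D g f * ℓL κ Φ t p D g f / shearUnit (nL κ Φ t p D g f) (hL κ Φ t p D g f) : ℕ) : ℤ) + 1 + qxY := by unfold kgqY; push_cast; ring
  have hqσ : ((kgqY κ Φ t p D g f qxY : ℕ) : ℤ) ≤ 21 * (kgSL (nL κ Φ t p D g f) (ℓL κ Φ t p D g f) (hL κ Φ t p D g f)) + 2 := by rw [eq_q]; linarith only [hPσ, hqx20]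
  have hq0 : (0 : ℤ) ≤ ((kgqY κ Φ t p D g f qxY : ℕ) : ℤ) := by positivity
  have hL6 : ((3 * (nL κ Φ t p D g f * ℓL κ Φ t p D g f) / shearUnit (nL κ Φ t p D g f) (hL κ Φ t p D g f) + 1 : ℕ) : ℤ) ≤ 3 * (kgSL (nL κ Φ t p D g f) (ℓL κ Φ t p D g f) (hL κ Φ t p D g f)) + 6 := by
    have h1 : ((3 * (nL κ Φ t p D g f * ℓL κ Φ t p D g f) / shearUnit (nL κ Φ t p D g f) (hL κ Φ t p D g f) : ℕ) : ℤ) ≤ 3 * ((nL κ Φ t p D g f * ℓL κ Φ t p D g f / shearUnit (nL κ Φ t p D g f) (hL κ Φ t p D g f) : ℕ) : ℤ) + 2 := by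
      exact_mod_cast Skelφ.natDiv_three_le (nL κ Φ t p D g f * ℓL κ Φ t p D g f) (shearUnit (nL κ Φ t p D g f) (hL κ Φ t p D g f)) (by exact_mod_cast hU0)
    push_cast at h1 ⊢; linarith only [h1, hPσ, ePn]
  have hL0 : (0 : ℤ) ≤ ((3 * (nL κ Φ t p D g f * ℓL κ Φ t p D g f) / shearUnit (nL κ Φ t p D g f) (hL κ Φ t p D g f) + 1 : ℕ) : ℤ) := by positivity
  -- m₂ ≤ 66 + 6kq
  obtain ⟨hsp2, -⟩ := H.kgM₂Y_spec (kgNYv0 κ Φ t p D g f mk qxY WxY)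
  have hR₁ := H.hR₁
  rw [kgSLY_eq_kgSL] at hR₁
  have ed2 : (Skelφ.kgDec₂Y (nL κ Φ t p D g f) (ℓL κ Φ t p D g f) (hL κ Φ t p D g f) (kgR κ Φ t p D mk) 0) = (kgSL (nL κ Φ t p D g f) (ℓL κ Φ t p D g f) (hL κ Φ t p D g f)) - 2 * ((kgR κ Φ t p D mk : ℕ) : ℤ) - ((0 : ℕ) : ℤ) := by unfold Skelφ.kgDec₂Y; rw [kgSLY_eq_kgSL]
  have hd2 : 2 * (kgSL (nL κ Φ t p D g f) (ℓL κ Φ t p D g f) (hL κ Φ t p D g f)) + 2 ≤ 3 * (Skelφ.kgDec₂Y (nL κ Φ t p D g f) (ℓL κ Φ t p D g f) (hL κ Φ t p D g f) (kgR κ Φ t p D mk) 0) := by rw [ed2]; push_cast at hR₁ ⊢; linarith only [hR₁]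
  have hd2pos : (0 : ℤ) < (Skelφ.kgDec₂Y (nL κ Φ t p D g f) (ℓL κ Φ t p D g f) (hL κ Φ t p D g f) (kgR κ Φ t p D mk) 0) := by linarith only [hd2, h958]
  have hdS2 : ((Skelφ.dS (nL κ Φ t p D g f) (ℓL κ Φ t p D g f) (hL κ Φ t p D g f) : ℕ) : ℤ) ≤ 2 := by exact_mod_cast Skelφ.dS_le_two _ _ _
  have eTY : (Skelφ.kgTY (nL κ Φ t p D g f) (ℓL κ Φ t p D g f) (hL κ Φ t p D g f) (vL κ Φ t p D g f) (kgR κ Φ t p D mk) 0 (kgqY κ Φ t p D g f qxY) (kgWY κ Φ t p D g f (KS.WxYR κ Φ t p D mk g f WxY)) (kgNYv0 κ Φ t p D g f mk qxY WxY)) = 2 * (((kgqY κ Φ t p D g f qxY : ℕ) : ℤ) + (((kgNYv0 κ Φ t p D g f mk qxY WxY : ℕ) : ℤ) + 1) * ((kgR κ Φ t p D mk : ℕ) : ℤ)) + (((kgNYv0 κ Φ t p D g f mk qxY WxY : ℕ) : ℤ) + 1) * ((Skelφ.dS (nL κ Φ t p D g f) (ℓL κ Φ t p D g f) (hL κ Φ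 t p D g f) : ℕ) : ℤ) + 2 * (((kgM₁Y (nL κ Φ t p D g f) (vL κ Φ t p D g f) (kgR κ Φ t p D mk) 0 (kgWY κ Φ t p D g f (KS.WxYR κ Φ t p D mk g f WxY)) (kgNYv0 κ Φ t p D g f mk qxY WxY) : ℕ) : ℤ) + 1) * (((kgR κ Φ t p D mk : ℕ) : ℤ) + ((0 : ℕ) : ℤ)) := by
    unfold Skelφ.kgTY; push_cast; ring
  have hkσ : 958 * ((Neg.Kq κ : ℕ) : ℤ) ≤ ((Neg.Kq κ : ℕ) : ℤ) * (kgSL (nL κ Φ t p D g f) (ℓL κ Φ t p D g f) (hL κ Φ t p D g f)) := by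
    have h0 := mul_le_mul_of_nonneg_left h958 hkq0; linarith only [h0]
  have hTY : (Skelφ.kgTY (nL κ Φ t p D g f) (ℓL κ Φ t p D g f) (hL κ Φ t p D g f) (vL κ Φ t p D g f) (kgR κ Φ t p D mk) 0 (kgqY κ Φ t p D g f qxY) (kgWY κ Φ t p D g f (KS.WxYR κ Φ t p D mk g f WxY)) (kgNYv0 κ Φ t p D g f mk qxY WxY)) ≤ (44 + 4 * ((Neg.Kq κ : ℕ) : ℤ)) * (kgSL (nL κ Φ t p D g f) (ℓL κ Φ t p D g f) (hL κ Φ t p D g f)) := by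
    have h1 : (((kgNYv0 κ Φ t p D g f mk qxY WxY : ℕ) : ℤ) + 1) * ((Skelφ.dS (nL κ Φ t p D g f) (ℓL κ Φ t p D g f) (hL κ Φ t p D g f) : ℕ) : ℤ) ≤ (840 * ((Neg.Kq κ : ℕ) : ℤ) + 3) * 2 := mul_le_mul hNK hdS2 (by positivity) (by positivity)
    rw [eTY, h00]; linarith only [hqσ, hNRσ, h1, hm1R, hR1600', hkσ, h958]
  have hTY0 : (0 : ℤ) ≤ (Skelφ.kgTY (nL κ Φ t p D g f) (ℓL κ Φ t p D g f) (hL κ Φ t p D g f) (vL κ Φ t p D g f) (kgR κ Φ t p D mk) 0 (kgqY κ Φ t p D g f qxY) (kgWY κ Φ t p D g f (KS.WxYR κ Φ t p D mk g f WxY)) (kgNYv0 κ Φ t p D g f mk qxY WxY)) := by rw [eTY]; positivity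
  have hm20 : (0 : ℤ) ≤ ((kgM₂Y (nL κ Φ t p D g f) (ℓL κ Φ t p D g f) (hL κ Φ t p D g f) (vL κ Φ t p D g f) (kgR κ Φ t p D mk) 0 (kgqY κ Φ t p D g f qxY) (kgWY κ Φ t p D g f (KS.WxYR κ Φ t p D mk g f WxY)) (kgNYv0 κ Φ t p D g f mk qxY WxY) : ℕ) : ℤ) := by positivity
  have hm2b : ((kgM₂Y (nL κ Φ t p D g f) (ℓL κ Φ t p D g f) (hL κ Φ t p D g f) (vL κ Φ t p D g f) (kgR κ Φ t p D mk) 0 (kgqY κ Φ t p D g f qxY) (kgWY κ Φ t p D g f (KS.WxYR κ Φ t p D mk g f WxY)) (kgNYv0 κ Φ t p D g f mk qxY WxY) : ℕ) : ℤ) ≤ 66 + 6 * ((Neg.Kq κ : ℕ) : ℤ) := by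
    have hmd : ((kgM₂Y (nL κ Φ t p D g f) (ℓL κ Φ t p D g f) (hL κ Φ t p D g f) (vL κ Φ t p D g f) (kgR κ Φ t p D mk) 0 (kgqY κ Φ t p D g f qxY) (kgWY κ Φ t p D g f (KS.WxYR κ Φ t p D mk g f WxY)) (kgNYv0 κ Φ t p D g f mk qxY WxY) : ℕ) : ℤ) * (Skelφ.kgDec₂Y (nL κ Φ t p D g f) (ℓL κ Φ t p D g f) (hL κ Φ t p D g f) (kgR κ Φ t p D mk) 0) ≤ (Skelφ.kgTY (nL κ Φ t p D g f) (ℓL κ Φ t p D g f) (hL κ Φ t p D g f) (vL κ Φ t p D g f) (kgR κ Φ t p D mk) 0 (kgqY κ Φ t p D g f qxY) (kgWY κ Φ t p D g f (KS.WxYR κ Φ t p D mk g f WxY)) (kgNYv0 κ Φ t p D g f mk qxY WxY)) := by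
      rcases le_total 1 (((Skelφ.kgTY (nL κ Φ t p D g f) (ℓL κ Φ t p D g f) (hL κ Φ t p D g f) (vL κ Φ t p D g f) (kgR κ Φ t p D mk) 0 (kgqY κ Φ t p D g f qxY) (kgWY κ Φ t p D g f (KS.WxYR κ Φ t p D mk g f WxY)) (kgNYv0 κ Φ t p D g f mk qxY WxY)) - (((nL κ Φ t p D g f : ℤ) * ℓL κ Φ t p D g f / (shearUnit (nL κ Φ t p D g f) (hL κ Φ t p D g f) : ℕ)) + 1 + ((0 : ℕ) : ℤ) - 1) + (Skelφ.kgDec₂Y (nL κ Φ t p D g f) (ℓL κ Φ t p D g f) (hL κ Φ t p D g f) (kgR κ Φ t p D mk) 0) - 1) / (Skelφ.kgDec₂Y (nL κ Φ t p D g f) (ℓL κ Φ t p D g f) (hL κ Φ t p D g f) (kgR κ Φ t p D mk) 0)) with hc | hc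
      · rw [max_eq_right hc] at hsp2
        have h1 : (((kgM₂Y (nL κ Φ t p D g f) (ℓL κ Φ t p D g f) (hL κ Φ t p D g f) (vL κ Φ t p D g f) (kgR κ Φ t p D mk) 0 (kgqY κ Φ t p D g f qxY) (kgWY κ Φ t p D g f (KS.WxYR κ Φ t p D mk g f WxY)) (kgNYv0 κ Φ t p D g f mk qxY WxY) : ℕ) : ℤ) + 1) * (Skelφ.kgDec₂Y (nL κ Φ t p D g f) (ℓL κ Φ t p D g f) (hL κ Φ t p D g f) (kgR κ Φ t p D mk) 0) ≤ (Skelφ.kgTY (nL κ Φ t p D g f) (ℓL κ Φ t p D g f) (hL κ Φ t p D g f) (vL κ Φ t p D g f) (kgR κ Φ t p D mk) 0 (kgqY κ Φ t p D g f qxY) (kgWY κ Φ t p D g f (KS.WxYR κ Φ t p D mk g f WxY)) (kgNYv0 κ Φ t p D g f mk qxY WxY)) - (((nL κ Φ t p D g f : ℤ) * ℓL κ Φ t p D g f / (shearUnit (nL κ Φ t p D g f) (hL κ Φ t p D g f) : ℕ)) + 1 + ((0 : ℕ) : ℤ) - 1) + (Skelφ.kgDec₂Y (nL κ Φ t p D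 g f) (ℓL κ Φ t p D g f) (hL κ Φ t p D g f) (kgR κ Φ t p D mk) 0) - 1 := by
          rw [hsp2]; exact Int.ediv_mul_le _ (ne_of_gt hd2pos)
        have hPz0 : (0 : ℤ) ≤ ((nL κ Φ t p D g f : ℤ) * ℓL κ Φ t p D g f / (shearUnit (nL κ Φ t p D g f) (hL κ Φ t p D g f) : ℕ)) := Int.ediv_nonneg (by positivity) hU0.le
        rw [h00] at h1; linarith only [h1, hPz0]
      · rw [max_eq_left hc] at hsp2
        have h1 : ((kgM₂Y (nL κ Φ t p D g f) (ℓL κ Φ t p D g f) (hL κ Φ t p D g f) (vL κ Φ t p D g f) (kgR κ Φ t p D mk) 0 (kgqY κ Φ t p D g f qxY) (kgWY κ Φ t p D g f (KS.WxYR κ Φ t p D mk g f WxY)) (kgNYv0 κ Φ t p D g f mk qxY WxY) : ℕ) : ℤ) = 0 := by linarith only [hsp2]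
        rw [h1, zero_mul]; exact hTY0
    have h2 : ((kgM₂Y (nL κ Φ t p D g f) (ℓL κ Φ t p D g f) (hL κ Φ t p D g f) (vL κ Φ t p D g f) (kgR κ Φ t p D mk) 0 (kgqY κ Φ t p D g f qxY) (kgWY κ Φ t p D g f (KS.WxYR κ Φ t p D mk g f WxY)) (kgNYv0 κ Φ t p D g f mk qxY WxY) : ℕ) : ℤ) * (2 * (kgSL (nL κ Φ t p D g f) (ℓL κ Φ t p D g f) (hL κ Φ t p D g f)) + 2) ≤ 3 * (Skelφ.kgTY (nL κ Φ t p D g f) (ℓL κ Φ t p D g f) (hL κ Φ t p D g f) (vL κ Φ t p D g f) (kgR κ Φ t p D mk) 0 (kgqY κ Φ t p D g f qxY) (kgWY κ Φ t p D g f (KS.WxYR κ Φ t p D mk g f WxY)) (kgNYv0 κ Φ t p D g f mk qxY WxY)) := by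
      have h0 := mul_le_mul_of_nonneg_left hd2 hm20; linarith only [h0, hmd]
    have h4 : ((kgM₂Y (nL κ Φ t p D g f) (ℓL κ Φ t p D g f) (hL κ Φ t p D g f) (vL κ Φ t p D g f) (kgR κ Φ t p D mk) 0 (kgqY κ Φ t p D g f qxY) (kgWY κ Φ t p D g f (KS.WxYR κ Φ t p D mk g f WxY)) (kgNYv0 κ Φ t p D g f mk qxY WxY) : ℕ) : ℤ) * (2 * (kgSL (nL κ Φ t p D g f) (ℓL κ Φ t p D g f) (hL κ Φ t p D g f))) ≤ (66 + 6 * ((Neg.Kq κ : ℕ) : ℤ)) * (2 * (kgSL (nL κ Φ t p D g f) (ℓL κ Φ t p D g f) (hL κ Φ t p D g f))) := by linarith only [h2, hTY, hm20]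
    exact le_of_mul_le_mul_right h4 (by linarith only [h958])
  -- the half-widths A∓
  have eAm : ((kgA₁Ym (nL κ Φ t p D g f) (vL κ Φ t p D g f) (kgR κ Φ t p D mk) (kgWY κ Φ t p D g f (KS.WxYR κ Φ t p D mk g f WxY)) (kgNYv0 κ Φ t p D g f mk qxY WxY) : ℕ) : ℤ) = ((nL κ Φ t p D g f : ℤ) + (vL κ Φ t p D g f)) + ((kgWY κ Φ t p D g f (KS.WxYR κ Φ t p D mk g f WxY) : ℕ) : ℤ) + (((kgNYv0 κ Φ t p D g f mk qxY WxY : ℕ) : ℤ) + 1) * ((kgR κ Φ t p D mk : ℕ) : ℤ) := by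
    unfold Skelφ.kgA₁Ym; push_cast; linarith only [htn1]
  have eAp : ((kgA₁Yp (nL κ Φ t p D g f) (vL κ Φ t p D g f) (kgR κ Φ t p D mk) (kgWY κ Φ t p D g f (KS.WxYR κ Φ t p D mk g f WxY)) (kgNYv0 κ Φ t p D g f mk qxY WxY) : ℕ) : ℤ) = ((nL κ Φ t p D g f : ℤ) - (vL κ Φ t p D g f)) + ((kgWY κ Φ t p D g f (KS.WxYR κ Φ t p D mk g f WxY) : ℕ) : ℤ) + (((kgNYv0 κ Φ t p D g f mk qxY WxY : ℕ) : ℤ) + 1) * ((kgR κ Φ t p D mk : ℕ) : ℤ) := by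
    unfold Skelφ.kgA₁Yp; push_cast; linarith only [htn2]
  have h52m : (52 : ℤ) + 3 * ((Neg.Kq κ : ℕ) : ℤ) ≤ (modulus (nL κ Φ t p D g f) (hL κ Φ t p D g f) (vL κ Φ t p D g f) (vβL κ Φ t p D g f)) := by linarith only [hU479, hUn, hKRq, hkqR]
  -- §c the region in its drift-paired box (run frame at `c₂`), then in the `t`-frame
  have hE : ((kgWm₂Y (nL κ Φ t p D g f) (vL κ Φ t p D g f) (kgR κ Φ t p D mk) 0 (kgWY κ Φ t p D g f (KS.WxYR κ Φ t p D mk g f WxY)) (kgNYv0 κ Φ t p D g f mk qxY WxY) : ℕ) : ℤ) + ((kgWp₂Y (nL κ Φ t p D g f) (vL κ Φ t p D g f) (kgR κ Φ t p D mk) 0 (kgWY κ Φ t p D g f (KS.WxYR κ Φ t p D mk g f WxY)) (kgNYv0 κ Φ t p D g f mk qxY WxY) : ℕ) : ℤ) ≤ ((kgE₁Y (nL κ Φ t p D g f) (vL κ Φ t p D g f) (kgR κ Φ t p D mk) 0 (kgWY κ Φ t p D g f (KS.WxYR κ Φ t p D mk g f WxY)) (kgNYv0 κ Φ t p D g f mk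 qxY WxY) : ℕ) : ℤ) := by exact_mod_cast (Skelφ.kgWm₂Y_add_kgWp₂Y (kgNYv0 κ Φ t p D g f mk qxY WxY)).le
  obtain ⟨k, hkN, b1, b2, b3, b4⟩ :=
    Skelφ.kgCorrSchedY_region_paired H.hn H.hv H.hlay (H.kgYVals_ok₁ (kgNYv0 κ Φ t p D g f mk qxY WxY)) (H.kgYVals_ok₂ (kgNYv0 κ Φ t p D g f mk qxY WxY)) (H.kgYVals_split (kgNYv0 κ Φ t p D g f mk qxY WxY)) hE hr hw
  have hk0 : (0 : ℤ) ≤ (k : ℤ) := by positivity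
  have hkN' : (k : ℤ) ≤ ((kgNYv0 κ Φ t p D g f mk qxY WxY : ℕ) : ℤ) + 1 := by exact_mod_cast hkN
  obtain ⟨hr0, hrn, -⟩ := rows_c₂_zero κ Φ t p D mk g f WxY hN
  have hbox : Skelφ.runX φ' c₂ (nL κ Φ t p D g f) (hL κ Φ t p D g f) 1 w ∈ Finset.Icc (![(k : ℤ) * (vL κ Φ t p D g f) - (((kgA₁Ym (nL κ Φ t p D g f) (vL κ Φ t p D g f) (kgR κ Φ t p D mk) (kgWY κ Φ t p D g f (KS.WxYR κ Φ t p D mk g f WxY)) (kgNYv0 κ Φ t p D g f mk qxY WxY) : ℕ) : ℤ) + 2 * (nL κ Φ t p D g f) + (kgR κ Φ t p D mk) + ((kgE₁Y (nL κ Φ t p D g f) (vL κ Φ t p D g f) (kgR κ Φ t p D mk) 0 (kgWY κ Φ t p D g f (KS.WxYR κ Φ t p D mk g f WxY)) (kgNYv0 κ Φ t p D g f mk qxY WxY) : ℕ) : ℤ) + ((kgM₂Y (nL κ Φ t p D g f) (ℓL κ Φ t p D g f) (hL κ Φ t p D g f) (vL κ Φ t p D g f) (kgR κ Φ t p D mk)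 0 (kgqY κ Φ t p D g f qxY) (kgWY κ Φ t p D g f (KS.WxYR κ Φ t p D mk g f WxY)) (kgNYv0 κ Φ t p D g f mk qxY WxY) : ℕ) : ℤ) * ((kgR κ Φ t p D mk) + ((0 : ℕ) : ℤ) + |vL κ Φ t p D g f|)), (k : ℤ) * (((nL κ Φ t p D g f : ℤ) * ℓL κ Φ t p D g f - (shearUnit (nL κ Φ t p D g f) (hL κ Φ t p D g f) : ℕ) + 1) / (shearUnit (nL κ Φ t p D g f) (hL κ Φ t p D g f) : ℕ)) - (((kgqY κ Φ t p D g f qxY : ℕ) : ℤ) + (((kgNYv0 κ Φ t p D g f mk qxY WxY : ℕ) : ℤ) + 1) * (kgR κ Φ t p D mk) + (((kgM₁Y (nL κ Φ t p D g f) (vL κ Φ t p D g f) (kgR κ Φ t p D mk) 0 (kgWY κ Φ t p D g f (KS.WxYR κ Φ t p D mk g f WxY)) (kgNYv0 κ Φ t p D g f mk qxY WxY) : ℕ) : ℤ) + 1) * ((kgR κ Φ t p D mk) + ((0 : ℕ) : ℤ)) + ((nL κ Φ t p D g f : ℤ) * ℓL κ Φ t p D g f / (shearUnit (nL κ Φ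 t p D g f) (hL κ Φ t p D g f) : ℕ) + 1) + (kgR κ Φ t p D mk) + ((3 * (nL κ Φ t p D g f * ℓL κ Φ t p D g f) / shearUnit (nL κ Φ t p D g f) (hL κ Φ t p D g f) + 1 : ℕ) : ℤ))])
      (![(k : ℤ) * (vL κ Φ t p D g f) + (((kgA₁Yp (nL κ Φ t p D g f) (vL κ Φ t p D g f) (kgR κ Φ t p D mk) (kgWY κ Φ t p D g f (KS.WxYR κ Φ t p D mk g f WxY)) (kgNYv0 κ Φ t p D g f mk qxY WxY) : ℕ) : ℤ) + (((kgM₁Y (nL κ Φ t p D g f) (vL κ Φ t p D g f) (kgR κ Φ t p D mk) 0 (kgWY κ Φ t p D g f (KS.WxYR κ Φ t p D mk g f WxY)) (kgNYv0 κ Φ t p D g f mk qxY WxY) : ℕ) : ℤ) + 1) * ((kgR κ Φ t p D mk) + ((0 : ℕ) : ℤ)) + ((kgM₂Y (nL κ Φ t p D g f) (ℓL κ Φ t p D g f) (hL κ Φ t p D g f) (vL κ Φ t p D g f) (kgR κ Φ t p D mk) 0 (kgqY κ Φ t p D g f qxY) (kgWY κ Φ t p D g f (KS.WxYR κ Φ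 t p D mk g f WxY)) (kgNYv0 κ Φ t p D g f mk qxY WxY) : ℕ) : ℤ) * ((kgR κ Φ t p D mk) + ((0 : ℕ) : ℤ) + |vL κ Φ t p D g f|) + (kgR κ Φ t p D mk) + (nL κ Φ t p D g f)), (k : ℤ) * ((nL κ Φ t p D g f : ℤ) * ℓL κ Φ t p D g f / (shearUnit (nL κ Φ t p D g f) (hL κ Φ t p D g f) : ℕ) + 1) + (((kgqY κ Φ t p D g f qxY : ℕ) : ℤ) + (((kgNYv0 κ Φ t p D g f mk qxY WxY : ℕ) : ℤ) + 1) * (kgR κ Φ t p D mk) + (((kgM₁Y (nL κ Φ t p D g f) (vL κ Φ t p D g f) (kgR κ Φ t p D mk) 0 (kgWY κ Φ t p D g f (KS.WxYR κ Φ t p D mk g f WxY)) (kgNYv0 κ Φ t p D g f mk qxY WxY) : ℕ) : ℤ) + 1) * ((kgR κ Φ t p D mk) + ((0 : ℕ) : ℤ)) + ((kgM₂Y (nL κ Φ t p D g f) (ℓL κ Φ t p D g f) (hL κ Φ t p D g f) (vL κ Φ t p D g f) (kgR κ Φ t p D mk) 0 (kgqY κ Φ t p D g f qxY) (kgWY κ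 Φ t p D g f (KS.WxYR κ Φ t p D mk g f WxY)) (kgNYv0 κ Φ t p D g f mk qxY WxY) : ℕ) : ℤ) * ((kgR κ Φ t p D mk) + ((0 : ℕ) : ℤ)) + (kgR κ Φ t p D mk) + ((3 * (nL κ Φ t p D g f * ℓL κ Φ t p D g f) / shearUnit (nL κ Φ t p D g f) (hL κ Φ t p D g f) + 1 : ℕ) : ℤ))]) := by
    rw [Finset.mem_Icc, Pi.le_def, Pi.le_def, Fin.forall_fin_two, Fin.forall_fin_two]
    simp only [Matrix.cons_val_zero, Matrix.cons_val_one, Matrix.cons_val_fin_one]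
    exact ⟨⟨b1, b3⟩, b2, b4⟩
  have hsh := Skelφ.runX_shift_mem_Icc t c₂ (nL κ Φ t p D g f) hn1 (hL κ Φ t p D g f) hX hY hr0 (lt_of_lt_of_le hrn hUn) hbox
  obtain ⟨LO, HI, eL0, eH0, eL1, eH1, hmem⟩ : ∃ LO HI : Site 2, LO 0 = (k : ℤ) * (vL κ Φ t p D g f) - (((kgA₁Ym (nL κ Φ t p D g f) (vL κ Φ t p D g f) (kgR κ Φ t p D mk) (kgWY κ Φ t p D g f (KS.WxYR κ Φ t p D mk g f WxY)) (kgNYv0 κ Φ t p D g f mk qxY WxY) : ℕ) : ℤ) + 2 * (nL κ Φ t p D g f) + (kgR κ Φ t p D mk) + ((kgE₁Y (nL κ Φ t p D g f) (vL κ Φ t p D g f) (kgR κ Φ t p D mk) 0 (kgWY κ Φ t p D g f (KS.WxYR κ Φ t p D mk g f WxY)) (kgNYv0 κ Φ t p D g f mk qxY WxY) : ℕ) : ℤ) + ((kgM₂Y (nL κ Φ t p D g f) (ℓL κ Φ t p D g f) (hL κ Φ t p D g f) (vL κ Φ t p D g f) (kgR κ Φ t p D mk) 0 (kgqY κ Φ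 t p D g f qxY) (kgWY κ Φ t p D g f (KS.WxYR κ Φ t p D mk g f WxY)) (kgNYv0 κ Φ t p D g f mk qxY WxY) : ℕ) : ℤ) * ((kgR κ Φ t p D mk) + ((0 : ℕ) : ℤ) + |vL κ Φ t p D g f|)) + (((KS.X2R κ Φ t p D mk g f WxY) : ℕ) : ℤ) ∧ HI 0 = (k : ℤ) * (vL κ Φ t p D g f) + (((kgA₁Yp (nL κ Φ t p D g f) (vL κ Φ t p D g f) (kgR κ Φ t p D mk) (kgWY κ Φ t p D g f (KS.WxYR κ Φ t p D mk g f WxY)) (kgNYv0 κ Φ t p D g f mk qxY WxY) : ℕ) : ℤ) + (((kgM₁Y (nL κ Φ t p D g f) (vL κ Φ t p D g f) (kgR κ Φ t p D mk) 0 (kgWY κ Φ t p D g f (KS.WxYR κ Φ t p D mk g f WxY)) (kgNYv0 κ Φ t p D g f mk qxY WxY) : ℕ) : ℤ) + 1) * ((kgR κ Φ t p D mk) + ((0 : ℕ) : ℤ)) + ((kgM₂Y (nL κ Φ t p D g f) (ℓL κ Φ t p D g f) (hL κ Φ t p D g f) (vL κ Φ t p D g f) (kgR κ Φ t p D mk)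 0 (kgqY κ Φ t p D g f qxY) (kgWY κ Φ t p D g f (KS.WxYR κ Φ t p D mk g f WxY)) (kgNYv0 κ Φ t p D g f mk qxY WxY) : ℕ) : ℤ) * ((kgR κ Φ t p D mk) + ((0 : ℕ) : ℤ) + |vL κ Φ t p D g f|) + (kgR κ Φ t p D mk) + (nL κ Φ t p D g f)) + (((KS.X2R κ Φ t p D mk g f WxY) : ℕ) : ℤ) ∧
      LO 1 = (k : ℤ) * (((nL κ Φ t p D g f : ℤ) * ℓL κ Φ t p D g f - (shearUnit (nL κ Φ t p D g f) (hL κ Φ t p D g f) : ℕ) + 1) / (shearUnit (nL κ Φ t p D g f) (hL κ Φ t p D g f) : ℕ)) - (((kgqY κ Φ t p D g f qxY : ℕ) : ℤ) + (((kgNYv0 κ Φ t p D g f mk qxY WxY : ℕ) : ℤ) + 1) * (kgR κ Φ t p D mk) + (((kgM₁Y (nL κ Φ t p D g f) (vL κ Φ t p D g f) (kgR κ Φ t p D mk) 0 (kgWY κ Φ t p D g f (KS.WxYR κ Φ t p D mk g f WxY)) (kgNYv0 κ Φ t p D g f mk qxY WxY) : ℕ) : ℤ) + 1) * ((kgR κ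 Φ t p D mk) + ((0 : ℕ) : ℤ)) + ((nL κ Φ t p D g f : ℤ) * ℓL κ Φ t p D g f / (shearUnit (nL κ Φ t p D g f) (hL κ Φ t p D g f) : ℕ) + 1) + (kgR κ Φ t p D mk) + ((3 * (nL κ Φ t p D g f * ℓL κ Φ t p D g f) / shearUnit (nL κ Φ t p D g f) (hL κ Φ t p D g f) + 1 : ℕ) : ℤ)) + 0 ∧ HI 1 = (k : ℤ) * ((nL κ Φ t p D g f : ℤ) * ℓL κ Φ t p D g f / (shearUnit (nL κ Φ t p D g f) (hL κ Φ t p D g f) : ℕ) + 1) + (((kgqY κ Φ t p D g f qxY : ℕ) : ℤ) + (((kgNYv0 κ Φ t p D g f mk qxY WxY : ℕ) : ℤ) + 1) * (kgR κ Φ t p D mk) + (((kgM₁Y (nL κ Φ t p D g f) (vL κ Φ t p D g f) (kgR κ Φ t p D mk) 0 (kgWY κ Φ t p D g f (KS.WxYR κ Φ t p D mk g f WxY)) (kgNYv0 κ Φ t p D g f mk qxY WxY) : ℕ) : ℤ) + 1) * ((kgR κ Φ t p D mk) + ((0 : ℕ) : ℤ)) + ((kgM₂Y (nL κ Φ t p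 D g f) (ℓL κ Φ t p D g f) (hL κ Φ t p D g f) (vL κ Φ t p D g f) (kgR κ Φ t p D mk) 0 (kgqY κ Φ t p D g f qxY) (kgWY κ Φ t p D g f (KS.WxYR κ Φ t p D mk g f WxY)) (kgNYv0 κ Φ t p D g f mk qxY WxY) : ℕ) : ℤ) * ((kgR κ Φ t p D mk) + ((0 : ℕ) : ℤ)) + (kgR κ Φ t p D mk) + ((3 * (nL κ Φ t p D g f * ℓL κ Φ t p D g f) / shearUnit (nL κ Φ t p D g f) (hL κ Φ t p D g f) + 1 : ℕ) : ℤ)) + 1 ∧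
      Skelφ.runX φ' t (nL κ Φ t p D g f) (hL κ Φ t p D g f) 1 w ∈ Finset.Icc LO HI :=
    ⟨_, _, by simp, by simp, by simp, by simp, hsh⟩
  have hne : LO 1 ≤ HI 1 := ((Finset.mem_Icc.1 hmem).1 1).trans ((Finset.mem_Icc.1 hmem).2 1)
  have hrd0 := fine_mem_rd_root κ Φ t p D g f hN hmem 0
  have hrd1 := fine_mem_rd_root κ Φ t p D g f hN hmem 1
  -- §d the paired reading numerators
  have hBm0 : (0 : ℤ) ≤ (((kgA₁Ym (nL κ Φ t p D g f) (vL κ Φ t p D g f) (kgR κ Φ t p D mk) (kgWY κ Φ t p D g f (KS.WxYR κ Φ t p D mk g f WxY)) (kgNYv0 κ Φ t p D g f mk qxY WxY) : ℕ) : ℤ) + 2 * (nL κ Φ t p D g f) + (kgR κ Φ t p D mk) + ((kgE₁Y (nL κ Φ t p D g f) (vL κ Φ t p D g f) (kgR κ Φ t p D mk) 0 (kgWY κ Φ t p D g f (KS.WxYR κ Φ t p D mk g f WxY)) (kgNYv0 κ Φ t p D g f mk qxY WxY) : ℕ) : ℤ) + ((kgM₂Y (nL κ Φ t p D g f) (ℓL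 κ Φ t p D g f) (hL κ Φ t p D g f) (vL κ Φ t p D g f) (kgR κ Φ t p D mk) 0 (kgqY κ Φ t p D g f qxY) (kgWY κ Φ t p D g f (KS.WxYR κ Φ t p D mk g f WxY)) (kgNYv0 κ Φ t p D g f mk qxY WxY) : ℕ) : ℤ) * ((kgR κ Φ t p D mk) + ((0 : ℕ) : ℤ) + |vL κ Φ t p D g f|)) := by positivity
  have hBp0 : (0 : ℤ) ≤ (((kgA₁Yp (nL κ Φ t p D g f) (vL κ Φ t p D g f) (kgR κ Φ t p D mk) (kgWY κ Φ t p D g f (KS.WxYR κ Φ t p D mk g f WxY)) (kgNYv0 κ Φ t p D g f mk qxY WxY) : ℕ) : ℤ) + (((kgM₁Y (nL κ Φ t p D g f) (vL κ Φ t p D g f) (kgR κ Φ t p D mk) 0 (kgWY κ Φ t p D g f (KS.WxYR κ Φ t p D mk g f WxY)) (kgNYv0 κ Φ t p D g f mk qxY WxY) : ℕ) : ℤ) + 1) * ((kgR κ Φ t p D mk) + ((0 : ℕ) : ℤ)) + ((kgM₂Y (nL κ Φ t p D g f) (ℓL κ Φ t p D g f) (hL κ Φ t p D g f) (vL κ Φ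 t p D g f) (kgR κ Φ t p D mk) 0 (kgqY κ Φ t p D g f qxY) (kgWY κ Φ t p D g f (KS.WxYR κ Φ t p D mk g f WxY)) (kgNYv0 κ Φ t p D g f mk qxY WxY) : ℕ) : ℤ) * ((kgR κ Φ t p D mk) + ((0 : ℕ) : ℤ) + |vL κ Φ t p D g f|) + (kgR κ Φ t p D mk) + (nL κ Φ t p D g f)) := by positivity
  have hQm1 : (1 : ℤ) ≤ (((kgqY κ Φ t p D g f qxY : ℕ) : ℤ) + (((kgNYv0 κ Φ t p D g f mk qxY WxY : ℕ) : ℤ) + 1) * (kgR κ Φ t p D mk) + (((kgM₁Y (nL κ Φ t p D g f) (vL κ Φ t p D g f) (kgR κ Φ t p D mk) 0 (kgWY κ Φ t p D g f (KS.WxYR κ Φ t p D mk g f WxY)) (kgNYv0 κ Φ t p D g f mk qxY WxY) : ℕ) : ℤ) + 1) * ((kgR κ Φ t p D mk) + ((0 : ℕ) : ℤ)) + ((nL κ Φ t p D g f : ℤ) * ℓL κ Φ t p D g f / (shearUnit (nL κ Φ t p D g f) (hL κ Φ t p D g f) : ℕ) + 1) + (kgR κ Φ t p D mk) + ((3 *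 (nL κ Φ t p D g f * ℓL κ Φ t p D g f) / shearUnit (nL κ Φ t p D g f) (hL κ Φ t p D g f) + 1 : ℕ) : ℤ)) := by
    have h0 : (0 : ℤ) ≤ (((kgM₁Y (nL κ Φ t p D g f) (vL κ Φ t p D g f) (kgR κ Φ t p D mk) 0 (kgWY κ Φ t p D g f (KS.WxYR κ Φ t p D mk g f WxY)) (kgNYv0 κ Φ t p D g f mk qxY WxY) : ℕ) : ℤ) + 1) * ((kgR κ Φ t p D mk) + ((0 : ℕ) : ℤ)) := by positivity
    linarith only [h0, hq0, hNR0, hsHi1, hR0, hL0]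
  have hQm0 : (0 : ℤ) ≤ (((kgqY κ Φ t p D g f qxY : ℕ) : ℤ) + (((kgNYv0 κ Φ t p D g f mk qxY WxY : ℕ) : ℤ) + 1) * (kgR κ Φ t p D mk) + (((kgM₁Y (nL κ Φ t p D g f) (vL κ Φ t p D g f) (kgR κ Φ t p D mk) 0 (kgWY κ Φ t p D g f (KS.WxYR κ Φ t p D mk g f WxY)) (kgNYv0 κ Φ t p D g f mk qxY WxY) : ℕ) : ℤ) + 1) * ((kgR κ Φ t p D mk) + ((0 : ℕ) : ℤ)) + ((nL κ Φ t p D g f : ℤ) * ℓL κ Φ t p D g f / (shearUnit (nL κ Φ t p D g f) (hL κ Φ t p D g f) : ℕ) + 1) + (kgR κ Φ t p D mk) + ((3 * (nL κ Φ t p D g f * ℓL κ Φ t p D g f) / shearUnit (nL κ Φ t p D g f) (hL κ Φ t p D g f) + 1 : ℕ) : ℤ)) := by linarith only [hQm1]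
  have hQp0 : (0 : ℤ) ≤ (((kgqY κ Φ t p D g f qxY : ℕ) : ℤ) + (((kgNYv0 κ Φ t p D g f mk qxY WxY : ℕ) : ℤ) + 1) * (kgR κ Φ t p D mk) + (((kgM₁Y (nL κ Φ t p D g f) (vL κ Φ t p D g f) (kgR κ Φ t p D mk) 0 (kgWY κ Φ t p D g f (KS.WxYR κ Φ t p D mk g f WxY)) (kgNYv0 κ Φ t p D g f mk qxY WxY) : ℕ) : ℤ) + 1) * ((kgR κ Φ t p D mk) + ((0 : ℕ) : ℤ)) + ((kgM₂Y (nL κ Φ t p D g f) (ℓL κ Φ t p D g f) (hL κ Φ t p D g f) (vL κ Φ t p D g f) (kgR κ Φ t p D mk) 0 (kgqY κ Φ t p D g f qxY) (kgWY κ Φ t p D g f (KS.WxYR κ Φ t p D mk g f WxY)) (kgNYv0 κ Φ t p D g f mk qxY WxY) : ℕ) : ℤ) * ((kgR κ Φ t p D mk) + ((0 : ℕ) : ℤ)) + (kgR κ Φ t p D mk) + ((3 * (nL κ Φ t p D g f * ℓL κ Φ t p D g f) / shearUnit (nL κ Φ t p D g f) (hL κ Φ t p D g f) + 1 : ℕ)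 : ℤ)) := by positivity
  obtain ⟨hpu, hpl⟩ := pairing_bounds (m := (modulus (nL κ Φ t p D g f) (hL κ Φ t p D g f) (vL κ Φ t p D g f) (vβL κ Φ t p D g f))) (U := (((shearUnit (nL κ Φ t p D g f) (hL κ Φ t p D g f) : ℕ)) : ℤ)) (v := (vL κ Φ t p D g f)) (σ := (((nL κ Φ t p D g f : ℤ) * ℓL κ Φ t p D g f - (shearUnit (nL κ Φ t p D g f) (hL κ Φ t p D g f) : ℕ) + 1) / (shearUnit (nL κ Φ t p D g f) (hL κ Φ t p D g f) : ℕ))) (σ' := ((nL κ Φ t p D g f : ℤ) * ℓL κ Φ t p D g f / (shearUnit (nL κ Φ t p D g f) (hL κ Φ t p D g f) : ℕ) + 1)) (X := (((KS.X2R κ Φ t p D mk g f WxY) : ℕ) : ℤ))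
    (B := (((kgA₁Ym (nL κ Φ t p D g f) (vL κ Φ t p D g f) (kgR κ Φ t p D mk) (kgWY κ Φ t p D g f (KS.WxYR κ Φ t p D mk g f WxY)) (kgNYv0 κ Φ t p D g f mk qxY WxY) : ℕ) : ℤ) + 2 * (nL κ Φ t p D g f) + (kgR κ Φ t p D mk) + ((kgE₁Y (nL κ Φ t p D g f) (vL κ Φ t p D g f) (kgR κ Φ t p D mk) 0 (kgWY κ Φ t p D g f (KS.WxYR κ Φ t p D mk g f WxY)) (kgNYv0 κ Φ t p D g f mk qxY WxY) : ℕ) : ℤ) + ((kgM₂Y (nL κ Φ t p D g f) (ℓL κ Φ t p D g f) (hL κ Φ t p D g f) (vL κ Φ t p D g f) (kgR κ Φ t p D mk) 0 (kgqY κ Φ t p D g f qxY) (kgWY κ Φ t p D g f (KS.WxYR κ Φ t p D mk g f WxY)) (kgNYv0 κ Φ t p D g f mk qxY WxY) : ℕ) : ℤ) * ((kgR κ Φ t p D mk) + ((0 : ℕ) : ℤ) + |vL κ Φ t p D g f|)) + (((kgA₁Yp (nL κ Φ t p D g f) (vL κ Φ t p D g f) (kgR κ Φ t p D mk) (kgWY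 κ Φ t p D g f (KS.WxYR κ Φ t p D mk g f WxY)) (kgNYv0 κ Φ t p D g f mk qxY WxY) : ℕ) : ℤ) + (((kgM₁Y (nL κ Φ t p D g f) (vL κ Φ t p D g f) (kgR κ Φ t p D mk) 0 (kgWY κ Φ t p D g f (KS.WxYR κ Φ t p D mk g f WxY)) (kgNYv0 κ Φ t p D g f mk qxY WxY) : ℕ) : ℤ) + 1) * ((kgR κ Φ t p D mk) + ((0 : ℕ) : ℤ)) + ((kgM₂Y (nL κ Φ t p D g f) (ℓL κ Φ t p D g f) (hL κ Φ t p D g f) (vL κ Φ t p D g f) (kgR κ Φ t p D mk) 0 (kgqY κ Φ t p D g f qxY) (kgWY κ Φ t p D g f (KS.WxYR κ Φ t p D mk g f WxY)) (kgNYv0 κ Φ t p D g f mk qxY WxY) : ℕ) : ℤ) * ((kgR κ Φ t p D mk) + ((0 : ℕ) : ℤ) + |vL κ Φ t p D g f|) + (kgR κ Φ t p D mk) + (nL κ Φ t p D g f))) (Q := (((kgqY κ Φ t p D g f qxY : ℕ) : ℤ) + (((kgNYv0 κ Φ t p D g f mk qxY WxY : ℕ) : ℤ) + 1) * (kgR κ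 Φ t p D mk) + (((kgM₁Y (nL κ Φ t p D g f) (vL κ Φ t p D g f) (kgR κ Φ t p D mk) 0 (kgWY κ Φ t p D g f (KS.WxYR κ Φ t p D mk g f WxY)) (kgNYv0 κ Φ t p D g f mk qxY WxY) : ℕ) : ℤ) + 1) * ((kgR κ Φ t p D mk) + ((0 : ℕ) : ℤ)) + ((nL κ Φ t p D g f : ℤ) * ℓL κ Φ t p D g f / (shearUnit (nL κ Φ t p D g f) (hL κ Φ t p D g f) : ℕ) + 1) + (kgR κ Φ t p D mk) + ((3 * (nL κ Φ t p D g f * ℓL κ Φ t p D g f) / shearUnit (nL κ Φ t p D g f) (hL κ Φ t p D g f) + 1 : ℕ) : ℤ)) + (((kgqY κ Φ t p D g f qxY : ℕ) : ℤ) + (((kgNYv0 κ Φ t p D g f mk qxY WxY : ℕ) : ℤ) + 1) * (kgR κ Φ t p D mk) + (((kgM₁Y (nL κ Φ t p D g f) (vL κ Φ t p D g f) (kgR κ Φ t p D mk) 0 (kgWY κ Φ t p D g f (KS.WxYR κ Φ t p D mk g f WxY)) (kgNYv0 κ Φ t p D g f mk qxY WxY) : ℕ) : ℤ) + 1) * ((kgR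 κ Φ t p D mk) + ((0 : ℕ) : ℤ)) + ((kgM₂Y (nL κ Φ t p D g f) (ℓL κ Φ t p D g f) (hL κ Φ t p D g f) (vL κ Φ t p D g f) (kgR κ Φ t p D mk) 0 (kgqY κ Φ t p D g f qxY) (kgWY κ Φ t p D g f (KS.WxYR κ Φ t p D mk g f WxY)) (kgNYv0 κ Φ t p D g f mk qxY WxY) : ℕ) : ℤ) * ((kgR κ Φ t p D mk) + ((0 : ℕ) : ℤ)) + (kgR κ Φ t p D mk) + ((3 * (nL κ Φ t p D g f * ℓL κ Φ t p D g f) / shearUnit (nL κ Φ t p D g f) (hL κ Φ t p D g f) + 1 : ℕ) : ℤ)) + 1) (k := (k : ℤ)) (Kb := ((kgNYv0 κ Φ t p D g f mk qxY WxY : ℕ) : ℤ) + 1) (nn := (nL κ Φ t p D g f : ℤ)) (lo := LO) (hi := HI)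
    hm.le (by linarith only [hU0]) hk0 hkN' hRv (by positivity) (by rw [← eσ]; exact hmσ1) hmσ3
    (by rw [eL0]; linarith only [hBp0]) (by rw [eH0]; linarith only [hBm0]) (by rw [eL1]; linarith only [hQp0])
    (by rw [eH1]; linarith only [hQm0]) hne
  -- §e the budgets (widths in `n_L`, row extents in `sL`, `U·sL ≤ m + 1`)
  have hB : (((KS.X2R κ Φ t p D mk g f WxY) : ℕ) : ℤ) + ((((kgA₁Ym (nL κ Φ t p D g f) (vL κ Φ t p D g f) (kgR κ Φ t p D mk) (kgWY κ Φ t p D g f (KS.WxYR κ Φ t p D mk g f WxY)) (kgNYv0 κ Φ t p D g f mk qxY WxY) : ℕ) : ℤ) + 2 * (nL κ Φ t p D g f) + (kgR κ Φ t p D mk) + ((kgE₁Y (nL κ Φ t p D g f) (vL κ Φ t p D g f) (kgR κ Φ t p D mk) 0 (kgWY κ Φ t p D g f (KS.WxYR κ Φ t p D mk g f WxY)) (kgNYv0 κ Φ t p D g f mk qxY WxY) : ℕ) : ℤ) + ((kgM₂Y (nL κ Φ t p D g f) (ℓL κ Φ t p D g f) (hL κ Φ t p D g f) (vL κ Φ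 t p D g f) (kgR κ Φ t p D mk) 0 (kgqY κ Φ t p D g f qxY) (kgWY κ Φ t p D g f (KS.WxYR κ Φ t p D mk g f WxY)) (kgNYv0 κ Φ t p D g f mk qxY WxY) : ℕ) : ℤ) * ((kgR κ Φ t p D mk) + ((0 : ℕ) : ℤ) + |vL κ Φ t p D g f|)) + (((kgA₁Yp (nL κ Φ t p D g f) (vL κ Φ t p D g f) (kgR κ Φ t p D mk) (kgWY κ Φ t p D g f (KS.WxYR κ Φ t p D mk g f WxY)) (kgNYv0 κ Φ t p D g f mk qxY WxY) : ℕ) : ℤ) + (((kgM₁Y (nL κ Φ t p D g f) (vL κ Φ t p D g f) (kgR κ Φ t p D mk) 0 (kgWY κ Φ t p D g f (KS.WxYR κ Φ t p D mk g f WxY)) (kgNYv0 κ Φ t p D g f mk qxY WxY) : ℕ) : ℤ) + 1) * ((kgR κ Φ t p D mk) + ((0 : ℕ) : ℤ)) + ((kgM₂Y (nL κ Φ t p D g f) (ℓL κ Φ t p D g f) (hL κ Φ t p D g f) (vL κ Φ t p D g f) (kgR κ Φ t p D mk) 0 (kgqY κ Φ t p D g f qxY) (kgWY κ Φ t p D g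 f (KS.WxYR κ Φ t p D mk g f WxY)) (kgNYv0 κ Φ t p D g f mk qxY WxY) : ℕ) : ℤ) * ((kgR κ Φ t p D mk) + ((0 : ℕ) : ℤ) + |vL κ Φ t p D g f|) + (kgR κ Φ t p D mk) + (nL κ Φ t p D g f))) ≤ (284 + 12 * ((Neg.Kq κ : ℕ) : ℤ)) * (nL κ Φ t p D g f : ℤ) := by
    have h1 : ((kgM₂Y (nL κ Φ t p D g f) (ℓL κ Φ t p D g f) (hL κ Φ t p D g f) (vL κ Φ t p D g f) (kgR κ Φ t p D mk) 0 (kgqY κ Φ t p D g f qxY) (kgWY κ Φ t p D g f (KS.WxYR κ Φ t p D mk g f WxY)) (kgNYv0 κ Φ t p D g f mk qxY WxY) : ℕ) : ℤ) * (((kgR κ Φ t p D mk : ℕ) : ℤ) + |vL κ Φ t p D g f|) ≤ (66 + 6 * ((Neg.Kq κ : ℕ) : ℤ)) * ((kgR κ Φ t p D mk : ℕ) : ℤ) + (66 + 6 * ((Neg.Kq κ : ℕ) : ℤ)) * (nL κ Φ t p D g f : ℤ) := by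
      have h0 : ((kgM₂Y (nL κ Φ t p D g f) (ℓL κ Φ t p D g f) (hL κ Φ t p D g f) (vL κ Φ t p D g f) (kgR κ Φ t p D mk) 0 (kgqY κ Φ t p D g f qxY) (kgWY κ Φ t p D g f (KS.WxYR κ Φ t p D mk g f WxY)) (kgNYv0 κ Φ t p D g f mk qxY WxY) : ℕ) : ℤ) * (((kgR κ Φ t p D mk : ℕ) : ℤ) + |vL κ Φ t p D g f|) ≤ ((kgM₂Y (nL κ Φ t p D g f) (ℓL κ Φ t p D g f) (hL κ Φ t p D g f) (vL κ Φ t p D g f) (kgR κ Φ t p D mk) 0 (kgqY κ Φ t p D g f qxY) (kgWY κ Φ t p D g f (KS.WxYR κ Φ t p D mk g f WxY)) (kgNYv0 κ Φ t p D g f mk qxY WxY) : ℕ) : ℤ) * (((kgR κ Φ t p D mk : ℕ) : ℤ) + (nL κ Φ t p D g f : ℤ)) := mul_le_mul_of_nonneg_left (by linarith only [hRv]) hm20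
      have h0' : ((kgM₂Y (nL κ Φ t p D g f) (ℓL κ Φ t p D g f) (hL κ Φ t p D g f) (vL κ Φ t p D g f) (kgR κ Φ t p D mk) 0 (kgqY κ Φ t p D g f qxY) (kgWY κ Φ t p D g f (KS.WxYR κ Φ t p D mk g f WxY)) (kgNYv0 κ Φ t p D g f mk qxY WxY) : ℕ) : ℤ) * (((kgR κ Φ t p D mk : ℕ) : ℤ) + (nL κ Φ t p D g f : ℤ)) ≤ (66 + 6 * ((Neg.Kq κ : ℕ) : ℤ)) * (((kgR κ Φ t p D mk : ℕ) : ℤ) + (nL κ Φ t p D g f : ℤ)) := mul_le_mul_of_nonneg_right hm2b (by positivity)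
      linarith only [h0, h0']
    have h2 : 20 * ((66 + 6 * ((Neg.Kq κ : ℕ) : ℤ)) * ((kgR κ Φ t p D mk : ℕ) : ℤ)) ≤ (nL κ Φ t p D g f : ℤ) := by linarith only [hKRq, hkR]
    have h3 : 412 * ((kgR κ Φ t p D mk : ℕ) : ℤ) * 4 ≤ (nL κ Φ t p D g f : ℤ) := by linarith only [hKRq, hkR5]
    rw [eAm, eAp, h00]
    linarith only [h1, h2, h3, hXWn, hW35, hNRn, hE5, hm1R, hn0, hR0]
  have hNU : 2 * (((shearUnit (nL κ Φ t p D g f) (hL κ Φ t p D g f) : ℕ)) : ℤ) * (((kgNYv0 κ Φ t p D g f mk qxY WxY : ℕ) : ℤ) + 1) ≤ 4 * ((Neg.Kq κ : ℕ) : ℤ) * (modulus (nL κ Φ t p D g f) (hL κ Φ t p D g f) (vL κ Φ t p D g f) (vβL κ Φ t p D g f)) := by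
    have h1 : 479 * (2 * (((shearUnit (nL κ Φ t p D g f) (hL κ Φ t p D g f) : ℕ)) : ℤ) * (((kgNYv0 κ Φ t p D g f mk qxY WxY : ℕ) : ℤ) + 1)) ≤ 2 * (((kgNYv0 κ Φ t p D g f mk qxY WxY : ℕ) : ℤ) + 1) * (modulus (nL κ Φ t p D g f) (hL κ Φ t p D g f) (vL κ Φ t p D g f) (vβL κ Φ t p D g f)) := by
      have h0 := mul_le_mul_of_nonneg_left hU479 (show (0 : ℤ) ≤ 2 * (((kgNYv0 κ Φ t p D g f mk qxY WxY : ℕ) : ℤ) + 1) by positivity); linarith only [h0]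
    have h2 : 2 * (((kgNYv0 κ Φ t p D g f mk qxY WxY : ℕ) : ℤ) + 1) * (modulus (nL κ Φ t p D g f) (hL κ Φ t p D g f) (vL κ Φ t p D g f) (vβL κ Φ t p D g f)) ≤ 2 * (840 * ((Neg.Kq κ : ℕ) : ℤ) + 3) * (modulus (nL κ Φ t p D g f) (hL κ Φ t p D g f) (vL κ Φ t p D g f) (vβL κ Φ t p D g f)) := mul_le_mul_of_nonneg_right (by linarith only [hNK]) hm.le
    have hkm : (modulus (nL κ Φ t p D g f) (hL κ Φ t p D g f) (vL κ Φ t p D g f) (vβL κ Φ t p D g f)) ≤ ((Neg.Kq κ : ℕ) : ℤ) * (modulus (nL κ Φ t p D g f) (hL κ Φ t p D g f) (vL κ Φ t p D g f) (vβL κ Φ t p D g f)) := by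
      have h0 := mul_le_mul_of_nonneg_right hkq1 hm.le; linarith only [h0]
    have h3 : 479 * (2 * (((shearUnit (nL κ Φ t p D g f) (hL κ Φ t p D g f) : ℕ)) : ℤ) * (((kgNYv0 κ Φ t p D g f mk qxY WxY : ℕ) : ℤ) + 1)) ≤ 479 * (4 * ((Neg.Kq κ : ℕ) : ℤ) * (modulus (nL κ Φ t p D g f) (hL κ Φ t p D g f) (vL κ Φ t p D g f) (vβL κ Φ t p D g f))) := by linarith only [h1, h2, hkm, hm]
    exact le_of_mul_le_mul_left h3 (by norm_num)
  have hQ : (((kgqY κ Φ t p D g f qxY : ℕ) : ℤ) + (((kgNYv0 κ Φ t p D g f mk qxY WxY : ℕ) : ℤ) + 1) * (kgR κ Φ t p D mk) + (((kgM₁Y (nL κ Φ t p D g f) (vL κ Φ t p D g f) (kgR κ Φ t p D mk) 0 (kgWY κ Φ t p D g f (KS.WxYR κ Φ t p D mk g f WxY)) (kgNYv0 κ Φ t p D g f mk qxY WxY) : ℕ) : ℤ) + 1) * ((kgR κ Φ t p D mk) + ((0 : ℕ) : ℤ)) + ((nL κ Φ t p D g f : ℤ) * ℓL κ Φ t p D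 g f / (shearUnit (nL κ Φ t p D g f) (hL κ Φ t p D g f) : ℕ) + 1) + (kgR κ Φ t p D mk) + ((3 * (nL κ Φ t p D g f * ℓL κ Φ t p D g f) / shearUnit (nL κ Φ t p D g f) (hL κ Φ t p D g f) + 1 : ℕ) : ℤ)) + (((kgqY κ Φ t p D g f qxY : ℕ) : ℤ) + (((kgNYv0 κ Φ t p D g f mk qxY WxY : ℕ) : ℤ) + 1) * (kgR κ Φ t p D mk) + (((kgM₁Y (nL κ Φ t p D g f) (vL κ Φ t p D g f) (kgR κ Φ t p D mk) 0 (kgWY κ Φ t p D g f (KS.WxYR κ Φ t p D mk g f WxY)) (kgNYv0 κ Φ t p D g f mk qxY WxY) : ℕ) : ℤ) + 1) * ((kgR κ Φ t p D mk) + ((0 : ℕ) : ℤ)) + ((kgM₂Y (nL κ Φ t p D g f) (ℓL κ Φ t p D g f) (hL κ Φ t p D g f) (vL κ Φ t p D g f) (kgR κ Φ t p D mk) 0 (kgqY κ Φ t p D g f qxY) (kgWY κ Φ t p D g f (KS.WxYR κ Φ t p D mk g f WxY)) (kgNYv0 κ Φ t p D g f mk qxY WxY) : ℕ) : ℤ)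 * ((kgR κ Φ t p D mk) + ((0 : ℕ) : ℤ)) + (kgR κ Φ t p D mk) + ((3 * (nL κ Φ t p D g f * ℓL κ Φ t p D g f) / shearUnit (nL κ Φ t p D g f) (hL κ Φ t p D g f) + 1 : ℕ) : ℤ)) + 2 ≤ (52 + 3 * ((Neg.Kq κ : ℕ) : ℤ)) * (kgSL (nL κ Φ t p D g f) (ℓL κ Φ t p D g f) (hL κ Φ t p D g f)) := by
    have h2 : ((kgM₂Y (nL κ Φ t p D g f) (ℓL κ Φ t p D g f) (hL κ Φ t p D g f) (vL κ Φ t p D g f) (kgR κ Φ t p D mk) 0 (kgqY κ Φ t p D g f qxY) (kgWY κ Φ t p D g f (KS.WxYR κ Φ t p D mk g f WxY)) (kgNYv0 κ Φ t p D g f mk qxY WxY) : ℕ) : ℤ) * ((kgR κ Φ t p D mk : ℕ) : ℤ) ≤ (kgSL (nL κ Φ t p D g f) (ℓL κ Φ t p D g f) (hL κ Φ t p D g f)) := by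
      have h0 : ((kgM₂Y (nL κ Φ t p D g f) (ℓL κ Φ t p D g f) (hL κ Φ t p D g f) (vL κ Φ t p D g f) (kgR κ Φ t p D mk) 0 (kgqY κ Φ t p D g f qxY) (kgWY κ Φ t p D g f (KS.WxYR κ Φ t p D mk g f WxY)) (kgNYv0 κ Φ t p D g f mk qxY WxY) : ℕ) : ℤ) * ((kgR κ Φ t p D mk : ℕ) : ℤ) ≤ (66 + 6 * ((Neg.Kq κ : ℕ) : ℤ)) * ((kgR κ Φ t p D mk : ℕ) : ℤ) := mul_le_mul_of_nonneg_right hm2b hR0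
      linarith only [h0, hKsq, hkR, h958]
    rw [h00]; linarith only [hqσ, hNRσ, hm1R, hR1600', hsHi, hL6, h2, h958, hkσ, hkq0]
  have hUQ2 : (((shearUnit (nL κ Φ t p D g f) (hL κ Φ t p D g f) : ℕ)) : ℤ) * ((((kgqY κ Φ t p D g f qxY : ℕ) : ℤ) + (((kgNYv0 κ Φ t p D g f mk qxY WxY : ℕ) : ℤ) + 1) * (kgR κ Φ t p D mk) + (((kgM₁Y (nL κ Φ t p D g f) (vL κ Φ t p D g f) (kgR κ Φ t p D mk) 0 (kgWY κ Φ t p D g f (KS.WxYR κ Φ t p D mk g f WxY)) (kgNYv0 κ Φ t p D g f mk qxY WxY) : ℕ) : ℤ) + 1) * ((kgR κ Φ t p D mk) + ((0 : ℕ) : ℤ)) + ((nL κ Φ t p D g f : ℤ) * ℓL κ Φ t p D g f / (shearUnit (nL κ Φ t p D g f) (hL κ Φ t p D g f) : ℕ) + 1) + (kgR κ Φ t p D mk) + ((3 * (nL κ Φ t p D g f * ℓL κ Φ t p D g f) / shearUnit (nL κ Φ t p D g f) (hL κ Φ t p D g f) + 1 : ℕ) : ℤ)) + (((kgqY κ Φ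 t p D g f qxY : ℕ) : ℤ) + (((kgNYv0 κ Φ t p D g f mk qxY WxY : ℕ) : ℤ) + 1) * (kgR κ Φ t p D mk) + (((kgM₁Y (nL κ Φ t p D g f) (vL κ Φ t p D g f) (kgR κ Φ t p D mk) 0 (kgWY κ Φ t p D g f (KS.WxYR κ Φ t p D mk g f WxY)) (kgNYv0 κ Φ t p D g f mk qxY WxY) : ℕ) : ℤ) + 1) * ((kgR κ Φ t p D mk) + ((0 : ℕ) : ℤ)) + ((kgM₂Y (nL κ Φ t p D g f) (ℓL κ Φ t p D g f) (hL κ Φ t p D g f) (vL κ Φ t p D g f) (kgR κ Φ t p D mk) 0 (kgqY κ Φ t p D g f qxY) (kgWY κ Φ t p D g f (KS.WxYR κ Φ t p D mk g f WxY)) (kgNYv0 κ Φ t p D g f mk qxY WxY) : ℕ) : ℤ) * ((kgR κ Φ t p D mk) + ((0 : ℕ) : ℤ)) + (kgR κ Φ t p D mk) + ((3 * (nL κ Φ t p D g f * ℓL κ Φ t p D g f) / shearUnit (nL κ Φ t p D g f) (hL κ Φ t p D g f) + 1 : ℕ) : ℤ)) + 2) ≤ (52 + 3 * ((Neg.Kq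 κ : ℕ) : ℤ)) * ((modulus (nL κ Φ t p D g f) (hL κ Φ t p D g f) (vL κ Φ t p D g f) (vβL κ Φ t p D g f)) + 1) := by
    calc (((shearUnit (nL κ Φ t p D g f) (hL κ Φ t p D g f) : ℕ)) : ℤ) * ((((kgqY κ Φ t p D g f qxY : ℕ) : ℤ) + (((kgNYv0 κ Φ t p D g f mk qxY WxY : ℕ) : ℤ) + 1) * (kgR κ Φ t p D mk) + (((kgM₁Y (nL κ Φ t p D g f) (vL κ Φ t p D g f) (kgR κ Φ t p D mk) 0 (kgWY κ Φ t p D g f (KS.WxYR κ Φ t p D mk g f WxY)) (kgNYv0 κ Φ t p D g f mk qxY WxY) : ℕ) : ℤ) + 1) * ((kgR κ Φ t p D mk) + ((0 : ℕ) : ℤ)) + ((nL κ Φ t p D g f : ℤ) * ℓL κ Φ t p D g f / (shearUnit (nL κ Φ t p D g f) (hL κ Φ t p D g f) : ℕ) + 1) + (kgR κ Φ t p D mk) + ((3 * (nL κ Φ t p D g f * ℓL κ Φ t p D g f) / shearUnit (nL κ Φ t p D g f) (hL κ Φ t p D g f) + 1 : ℕ) : ℤ)) + (((kgqY κ Φ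 t p D g f qxY : ℕ) : ℤ) + (((kgNYv0 κ Φ t p D g f mk qxY WxY : ℕ) : ℤ) + 1) * (kgR κ Φ t p D mk) + (((kgM₁Y (nL κ Φ t p D g f) (vL κ Φ t p D g f) (kgR κ Φ t p D mk) 0 (kgWY κ Φ t p D g f (KS.WxYR κ Φ t p D mk g f WxY)) (kgNYv0 κ Φ t p D g f mk qxY WxY) : ℕ) : ℤ) + 1) * ((kgR κ Φ t p D mk) + ((0 : ℕ) : ℤ)) + ((kgM₂Y (nL κ Φ t p D g f) (ℓL κ Φ t p D g f) (hL κ Φ t p D g f) (vL κ Φ t p D g f) (kgR κ Φ t p D mk) 0 (kgqY κ Φ t p D g f qxY) (kgWY κ Φ t p D g f (KS.WxYR κ Φ t p D mk g f WxY)) (kgNYv0 κ Φ t p D g f mk qxY WxY) : ℕ) : ℤ) * ((kgR κ Φ t p D mk) + ((0 : ℕ) : ℤ)) + (kgR κ Φ t p D mk) + ((3 * (nL κ Φ t p D g f * ℓL κ Φ t p D g f) / shearUnit (nL κ Φ t p D g f) (hL κ Φ t p D g f) + 1 : ℕ) : ℤ)) + 2) ≤ (((shearUnit (nL κ Φ t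 p D g f) (hL κ Φ t p D g f) : ℕ)) : ℤ) * ((52 + 3 * ((Neg.Kq κ : ℕ) : ℤ)) * (kgSL (nL κ Φ t p D g f) (ℓL κ Φ t p D g f) (hL κ Φ t p D g f))) := mul_le_mul_of_nonneg_left hQ hU0.le
      _ = (52 + 3 * ((Neg.Kq κ : ℕ) : ℤ)) * ((((shearUnit (nL κ Φ t p D g f) (hL κ Φ t p D g f) : ℕ)) : ℤ) * (kgSL (nL κ Φ t p D g f) (ℓL κ Φ t p D g f) (hL κ Φ t p D g f))) := by ring
      _ ≤ (52 + 3 * ((Neg.Kq κ : ℕ) : ℤ)) * ((modulus (nL κ Φ t p D g f) (hL κ Φ t p D g f) (vL κ Φ t p D g f) (vβL κ Φ t p D g f)) + 1) := mul_le_mul_of_nonneg_left hUσm (by positivity)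
  have hUQ3 : (((shearUnit (nL κ Φ t p D g f) (hL κ Φ t p D g f) : ℕ)) : ℤ) * ((((kgqY κ Φ t p D g f qxY : ℕ) : ℤ) + (((kgNYv0 κ Φ t p D g f mk qxY WxY : ℕ) : ℤ) + 1) * (kgR κ Φ t p D mk) + (((kgM₁Y (nL κ Φ t p D g f) (vL κ Φ t p D g f) (kgR κ Φ t p D mk) 0 (kgWY κ Φ t p D g f (KS.WxYR κ Φ t p D mk g f WxY)) (kgNYv0 κ Φ t p D g f mk qxY WxY) : ℕ) : ℤ) + 1) * ((kgR κ Φ t p D mk) + ((0 : ℕ) : ℤ)) + ((nL κ Φ t p D g f : ℤ) * ℓL κ Φ t p D g f / (shearUnit (nL κ Φ t p D g f) (hL κ Φ t p D g f) : ℕ) + 1) + (kgR κ Φ t p D mk) + ((3 * (nL κ Φ t p D g f * ℓL κ Φ t p D g f) / shearUnit (nL κ Φ t p D g f) (hL κ Φ t p D g f) + 1 : ℕ) : ℤ)) + (((kgqY κ Φ t p D g f qxY : ℕ) : ℤ) + (((kgNYv0 κ Φ t p D g f mk qxY WxY : ℕ) : ℤ) + 1) * (kgR κ Φ t p D mk)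 + (((kgM₁Y (nL κ Φ t p D g f) (vL κ Φ t p D g f) (kgR κ Φ t p D mk) 0 (kgWY κ Φ t p D g f (KS.WxYR κ Φ t p D mk g f WxY)) (kgNYv0 κ Φ t p D g f mk qxY WxY) : ℕ) : ℤ) + 1) * ((kgR κ Φ t p D mk) + ((0 : ℕ) : ℤ)) + ((kgM₂Y (nL κ Φ t p D g f) (ℓL κ Φ t p D g f) (hL κ Φ t p D g f) (vL κ Φ t p D g f) (kgR κ Φ t p D mk) 0 (kgqY κ Φ t p D g f qxY) (kgWY κ Φ t p D g f (KS.WxYR κ Φ t p D mk g f WxY)) (kgNYv0 κ Φ t p D g f mk qxY WxY) : ℕ) : ℤ) * ((kgR κ Φ t p D mk) + ((0 : ℕ) : ℤ)) + (kgR κ Φ t p D mk) + ((3 * (nL κ Φ t p D g f * ℓL κ Φ t p D g f) / shearUnit (nL κ Φ t p D g f) (hL κ Φ t p D g f) + 1 : ℕ) : ℤ)) + 2) ≤ (53 + 3 * ((Neg.Kq κ : ℕ) : ℤ)) * (modulus (nL κ Φ t p D g f) (hL κ Φ t p D g f) (vL κ Φ t p D g f) (vβL κ Φ t p D g f)) :=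 by linarith only [hUQ2, h52m]
  have hnmn : (nL κ Φ t p D g f : ℤ) ≤ (modulus (nL κ Φ t p D g f) (hL κ Φ t p D g f) (vL κ Φ t p D g f) (vβL κ Φ t p D g f)) * (nL κ Φ t p D g f : ℤ) := by
    have h0 := mul_le_mul_of_nonneg_right (show (1 : ℤ) ≤ (modulus (nL κ Φ t p D g f) (hL κ Φ t p D g f) (vL κ Φ t p D g f) (vβL κ Φ t p D g f)) by linarith only [hm]) hn0.le
    linarith only [h0]
  have hUQ : (nL κ Φ t p D g f : ℤ) * ((((shearUnit (nL κ Φ t p D g f) (hL κ Φ t p D g f) : ℕ)) : ℤ) * ((((kgqY κ Φ t p D g f qxY : ℕ) : ℤ) + (((kgNYv0 κ Φ t p D g f mk qxY WxY : ℕ) : ℤ) + 1) * (kgR κ Φ t p D mk) + (((kgM₁Y (nL κ Φ t p D g f) (vL κ Φ t p D g f) (kgR κ Φ t p D mk) 0 (kgWY κ Φ t p D g f (KS.WxYR κ Φ t p D mk g f WxY)) (kgNYv0 κ Φ t p D g f mk qxY WxY) : ℕ) : ℤ) + 1) * ((kgR κ Φ t p D mk) + ((0 : ℕ) : ℤ))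 + ((nL κ Φ t p D g f : ℤ) * ℓL κ Φ t p D g f / (shearUnit (nL κ Φ t p D g f) (hL κ Φ t p D g f) : ℕ) + 1) + (kgR κ Φ t p D mk) + ((3 * (nL κ Φ t p D g f * ℓL κ Φ t p D g f) / shearUnit (nL κ Φ t p D g f) (hL κ Φ t p D g f) + 1 : ℕ) : ℤ)) + (((kgqY κ Φ t p D g f qxY : ℕ) : ℤ) + (((kgNYv0 κ Φ t p D g f mk qxY WxY : ℕ) : ℤ) + 1) * (kgR κ Φ t p D mk) + (((kgM₁Y (nL κ Φ t p D g f) (vL κ Φ t p D g f) (kgR κ Φ t p D mk) 0 (kgWY κ Φ t p D g f (KS.WxYR κ Φ t p D mk g f WxY)) (kgNYv0 κ Φ t p D g f mk qxY WxY) : ℕ) : ℤ) + 1) * ((kgR κ Φ t p D mk) + ((0 : ℕ) : ℤ)) + ((kgM₂Y (nL κ Φ t p D g f) (ℓL κ Φ t p D g f) (hL κ Φ t p D g f) (vL κ Φ t p D g f) (kgR κ Φ t p D mk) 0 (kgqY κ Φ t p D g f qxY) (kgWY κ Φ t p D g f (KS.WxYR κ Φ t p D mk g f WxY)) (kgNYv0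 κ Φ t p D g f mk qxY WxY) : ℕ) : ℤ) * ((kgR κ Φ t p D mk) + ((0 : ℕ) : ℤ)) + (kgR κ Φ t p D mk) + ((3 * (nL κ Φ t p D g f * ℓL κ Φ t p D g f) / shearUnit (nL κ Φ t p D g f) (hL κ Φ t p D g f) + 1 : ℕ) : ℤ)) + 1) + (((shearUnit (nL κ Φ t p D g f) (hL κ Φ t p D g f) : ℕ)) : ℤ)) ≤ (53 + 3 * ((Neg.Kq κ : ℕ) : ℤ)) * ((modulus (nL κ Φ t p D g f) (hL κ Φ t p D g f) (vL κ Φ t p D g f) (vβL κ Φ t p D g f)) * (nL κ Φ t p D g f : ℤ)) := by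
    have h1 : (((shearUnit (nL κ Φ t p D g f) (hL κ Φ t p D g f) : ℕ)) : ℤ) * ((((kgqY κ Φ t p D g f qxY : ℕ) : ℤ) + (((kgNYv0 κ Φ t p D g f mk qxY WxY : ℕ) : ℤ) + 1) * (kgR κ Φ t p D mk) + (((kgM₁Y (nL κ Φ t p D g f) (vL κ Φ t p D g f) (kgR κ Φ t p D mk) 0 (kgWY κ Φ t p D g f (KS.WxYR κ Φ t p D mk g f WxY)) (kgNYv0 κ Φ t p D g f mk qxY WxY) : ℕ) : ℤ) + 1) * ((kgR κ Φ t p D mk) + ((0 : ℕ) : ℤ)) + ((nL κ Φ t p D g f : ℤ) * ℓL κ Φ t p D g f / (shearUnit (nL κ Φ t p D g f) (hL κ Φ t p D g f) : ℕ) + 1) + (kgR κ Φ t p D mk) + ((3 * (nL κ Φ t p D g f * ℓL κ Φ t p D g f) / shearUnit (nL κ Φ t p D g f) (hL κ Φ t p D g f) + 1 : ℕ) : ℤ)) + (((kgqY κ Φ t p D g f qxY : ℕ) : ℤ) + (((kgNYv0 κ Φ t p D g f mk qxY WxY : ℕ) : ℤ) + 1) * (kgR κ Φ t p D mk) + (((kgM₁Y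 (nL κ Φ t p D g f) (vL κ Φ t p D g f) (kgR κ Φ t p D mk) 0 (kgWY κ Φ t p D g f (KS.WxYR κ Φ t p D mk g f WxY)) (kgNYv0 κ Φ t p D g f mk qxY WxY) : ℕ) : ℤ) + 1) * ((kgR κ Φ t p D mk) + ((0 : ℕ) : ℤ)) + ((kgM₂Y (nL κ Φ t p D g f) (ℓL κ Φ t p D g f) (hL κ Φ t p D g f) (vL κ Φ t p D g f) (kgR κ Φ t p D mk) 0 (kgqY κ Φ t p D g f qxY) (kgWY κ Φ t p D g f (KS.WxYR κ Φ t p D mk g f WxY)) (kgNYv0 κ Φ t p D g f mk qxY WxY) : ℕ) : ℤ) * ((kgR κ Φ t p D mk) + ((0 : ℕ) : ℤ)) + (kgR κ Φ t p D mk) + ((3 * (nL κ Φ t p D g f * ℓL κ Φ t p D g f) / shearUnit (nL κ Φ t p D g f) (hL κ Φ t p D g f) + 1 : ℕ) : ℤ)) + 1) + (((shearUnit (nL κ Φ t p D g f) (hL κ Φ t p D g f) : ℕ)) : ℤ) = (((shearUnit (nL κ Φ t p D g f) (hL κ Φ t p D g f) : ℕ)) : ℤ) * ((((kgqY κ Φ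 t p D g f qxY : ℕ) : ℤ) + (((kgNYv0 κ Φ t p D g f mk qxY WxY : ℕ) : ℤ) + 1) * (kgR κ Φ t p D mk) + (((kgM₁Y (nL κ Φ t p D g f) (vL κ Φ t p D g f) (kgR κ Φ t p D mk) 0 (kgWY κ Φ t p D g f (KS.WxYR κ Φ t p D mk g f WxY)) (kgNYv0 κ Φ t p D g f mk qxY WxY) : ℕ) : ℤ) + 1) * ((kgR κ Φ t p D mk) + ((0 : ℕ) : ℤ)) + ((nL κ Φ t p D g f : ℤ) * ℓL κ Φ t p D g f / (shearUnit (nL κ Φ t p D g f) (hL κ Φ t p D g f) : ℕ) + 1) + (kgR κ Φ t p D mk) + ((3 * (nL κ Φ t p D g f * ℓL κ Φ t p D g f) / shearUnit (nL κ Φ t p D g f) (hL κ Φ t p D g f) + 1 : ℕ) : ℤ)) + (((kgqY κ Φ t p D g f qxY : ℕ) : ℤ) + (((kgNYv0 κ Φ t p D g f mk qxY WxY : ℕ) : ℤ) + 1) * (kgR κ Φ t p D mk) + (((kgM₁Y (nL κ Φ t p D g f) (vL κ Φ t p D g f) (kgR κ Φ t p D mk) 0 (kgWY κ Φ t p D g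 f (KS.WxYR κ Φ t p D mk g f WxY)) (kgNYv0 κ Φ t p D g f mk qxY WxY) : ℕ) : ℤ) + 1) * ((kgR κ Φ t p D mk) + ((0 : ℕ) : ℤ)) + ((kgM₂Y (nL κ Φ t p D g f) (ℓL κ Φ t p D g f) (hL κ Φ t p D g f) (vL κ Φ t p D g f) (kgR κ Φ t p D mk) 0 (kgqY κ Φ t p D g f qxY) (kgWY κ Φ t p D g f (KS.WxYR κ Φ t p D mk g f WxY)) (kgNYv0 κ Φ t p D g f mk qxY WxY) : ℕ) : ℤ) * ((kgR κ Φ t p D mk) + ((0 : ℕ) : ℤ)) + (kgR κ Φ t p D mk) + ((3 * (nL κ Φ t p D g f * ℓL κ Φ t p D g f) / shearUnit (nL κ Φ t p D g f) (hL κ Φ t p D g f) + 1 : ℕ) : ℤ)) + 2) := by ring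
    rw [h1]
    have h2 := mul_le_mul_of_nonneg_left hUQ3 hn0.le
    linarith only [h2]
  have hS : (modulus (nL κ Φ t p D g f) (hL κ Φ t p D g f) (vL κ Φ t p D g f) (vβL κ Φ t p D g f)) * ((((KS.X2R κ Φ t p D mk g f WxY) : ℕ) : ℤ) + ((((kgA₁Ym (nL κ Φ t p D g f) (vL κ Φ t p D g f) (kgR κ Φ t p D mk) (kgWY κ Φ t p D g f (KS.WxYR κ Φ t p D mk g f WxY)) (kgNYv0 κ Φ t p D g f mk qxY WxY) : ℕ) : ℤ) + 2 * (nL κ Φ t p D g f) + (kgR κ Φ t p D mk) + ((kgE₁Y (nL κ Φ t p D g f) (vL κ Φ t p D g f) (kgR κ Φ t p D mk) 0 (kgWY κ Φ t p D g f (KS.WxYR κ Φ t p D mk g f WxY)) (kgNYv0 κ Φ t p D g f mk qxY WxY) : ℕ) : ℤ) + ((kgM₂Y (nL κ Φ t p D g f) (ℓL κ Φ t p D g f) (hL κ Φ t p D g f) (vL κ Φ t p D g f) (kgR κ Φ t p D mk) 0 (kgqY κ Φ t p D g f qxY) (kgWY κ Φ t p D g f (KS.WxYR κ Φ t p D mk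 g f WxY)) (kgNYv0 κ Φ t p D g f mk qxY WxY) : ℕ) : ℤ) * ((kgR κ Φ t p D mk) + ((0 : ℕ) : ℤ) + |vL κ Φ t p D g f|)) + (((kgA₁Yp (nL κ Φ t p D g f) (vL κ Φ t p D g f) (kgR κ Φ t p D mk) (kgWY κ Φ t p D g f (KS.WxYR κ Φ t p D mk g f WxY)) (kgNYv0 κ Φ t p D g f mk qxY WxY) : ℕ) : ℤ) + (((kgM₁Y (nL κ Φ t p D g f) (vL κ Φ t p D g f) (kgR κ Φ t p D mk) 0 (kgWY κ Φ t p D g f (KS.WxYR κ Φ t p D mk g f WxY)) (kgNYv0 κ Φ t p D g f mk qxY WxY) : ℕ) : ℤ) + 1) * ((kgR κ Φ t p D mk) + ((0 : ℕ) : ℤ)) + ((kgM₂Y (nL κ Φ t p D g f) (ℓL κ Φ t p D g f) (hL κ Φ t p D g f) (vL κ Φ t p D g f) (kgR κ Φ t p D mk) 0 (kgqY κ Φ t p D g f qxY) (kgWY κ Φ t p D g f (KS.WxYR κ Φ t p D mk g f WxY)) (kgNYv0 κ Φ t p D g f mk qxY WxY) : ℕ) : ℤ) * ((kgR κ Φ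 t p D mk) + ((0 : ℕ) : ℤ) + |vL κ Φ t p D g f|) + (kgR κ Φ t p D mk) + (nL κ Φ t p D g f)))) + 2 * (((shearUnit (nL κ Φ t p D g f) (hL κ Φ t p D g f) : ℕ)) : ℤ) * (((kgNYv0 κ Φ t p D g f mk qxY WxY : ℕ) : ℤ) + 1) * (nL κ Φ t p D g f : ℤ) + (nL κ Φ t p D g f : ℤ) * ((((shearUnit (nL κ Φ t p D g f) (hL κ Φ t p D g f) : ℕ)) : ℤ) * ((((kgqY κ Φ t p D g f qxY : ℕ) : ℤ) + (((kgNYv0 κ Φ t p D g f mk qxY WxY : ℕ) : ℤ) + 1) * (kgR κ Φ t p D mk) + (((kgM₁Y (nL κ Φ t p D g f) (vL κ Φ t p D g f) (kgR κ Φ t p D mk) 0 (kgWY κ Φ t p D g f (KS.WxYR κ Φ t p D mk g f WxY)) (kgNYv0 κ Φ t p D g f mk qxY WxY) : ℕ) : ℤ) + 1) * ((kgR κ Φ t p D mk) + ((0 : ℕ) : ℤ)) + ((nL κ Φ t p D g f : ℤ) * ℓL κ Φ t p D g f / (shearUnit (nL κ Φ t p D g f) (hL κ Φ t p D g f) : ℕ)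 + 1) + (kgR κ Φ t p D mk) + ((3 * (nL κ Φ t p D g f * ℓL κ Φ t p D g f) / shearUnit (nL κ Φ t p D g f) (hL κ Φ t p D g f) + 1 : ℕ) : ℤ)) + (((kgqY κ Φ t p D g f qxY : ℕ) : ℤ) + (((kgNYv0 κ Φ t p D g f mk qxY WxY : ℕ) : ℤ) + 1) * (kgR κ Φ t p D mk) + (((kgM₁Y (nL κ Φ t p D g f) (vL κ Φ t p D g f) (kgR κ Φ t p D mk) 0 (kgWY κ Φ t p D g f (KS.WxYR κ Φ t p D mk g f WxY)) (kgNYv0 κ Φ t p D g f mk qxY WxY) : ℕ) : ℤ) + 1) * ((kgR κ Φ t p D mk) + ((0 : ℕ) : ℤ)) + ((kgM₂Y (nL κ Φ t p D g f) (ℓL κ Φ t p D g f) (hL κ Φ t p D g f) (vL κ Φ t p D g f) (kgR κ Φ t p D mk) 0 (kgqY κ Φ t p D g f qxY) (kgWY κ Φ t p D g f (KS.WxYR κ Φ t p D mk g f WxY)) (kgNYv0 κ Φ t p D g f mk qxY WxY) : ℕ) : ℤ) * ((kgR κ Φ t p D mk) + ((0 : ℕ) : ℤ)) + (kgR κ Φ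 t p D mk) + ((3 * (nL κ Φ t p D g f * ℓL κ Φ t p D g f) / shearUnit (nL κ Φ t p D g f) (hL κ Φ t p D g f) + 1 : ℕ) : ℤ)) + 1) + (((shearUnit (nL κ Φ t p D g f) (hL κ Φ t p D g f) : ℕ)) : ℤ)) ≤
      (337 + 19 * ((Neg.Kq κ : ℕ) : ℤ)) * ((modulus (nL κ Φ t p D g f) (hL κ Φ t p D g f) (vL κ Φ t p D g f) (vβL κ Φ t p D g f)) * (nL κ Φ t p D g f : ℤ)) := by
    have h1 : (modulus (nL κ Φ t p D g f) (hL κ Φ t p D g f) (vL κ Φ t p D g f) (vβL κ Φ t p D g f)) * ((((KS.X2R κ Φ t p D mk g f WxY) : ℕ) : ℤ) + ((((kgA₁Ym (nL κ Φ t p D g f) (vL κ Φ t p D g f) (kgR κ Φ t p D mk) (kgWY κ Φ t p D g f (KS.WxYR κ Φ t p D mk g f WxY)) (kgNYv0 κ Φ t p D g f mk qxY WxY) : ℕ) : ℤ) + 2 * (nL κ Φ t p D g f) + (kgR κ Φ t p D mk) + ((kgE₁Y (nL κ Φ t p D g f) (vL κ Φ t p D g f) (kgR κ Φ t p D mk)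 0 (kgWY κ Φ t p D g f (KS.WxYR κ Φ t p D mk g f WxY)) (kgNYv0 κ Φ t p D g f mk qxY WxY) : ℕ) : ℤ) + ((kgM₂Y (nL κ Φ t p D g f) (ℓL κ Φ t p D g f) (hL κ Φ t p D g f) (vL κ Φ t p D g f) (kgR κ Φ t p D mk) 0 (kgqY κ Φ t p D g f qxY) (kgWY κ Φ t p D g f (KS.WxYR κ Φ t p D mk g f WxY)) (kgNYv0 κ Φ t p D g f mk qxY WxY) : ℕ) : ℤ) * ((kgR κ Φ t p D mk) + ((0 : ℕ) : ℤ) + |vL κ Φ t p D g f|)) + (((kgA₁Yp (nL κ Φ t p D g f) (vL κ Φ t p D g f) (kgR κ Φ t p D mk) (kgWY κ Φ t p D g f (KS.WxYR κ Φ t p D mk g f WxY)) (kgNYv0 κ Φ t p D g f mk qxY WxY) : ℕ) : ℤ) + (((kgM₁Y (nL κ Φ t p D g f) (vL κ Φ t p D g f) (kgR κ Φ t p D mk) 0 (kgWY κ Φ t p D g f (KS.WxYR κ Φ t p D mk g f WxY)) (kgNYv0 κ Φ t p D g f mk qxY WxY) : ℕ) : ℤ) + 1) * ((kgR κ Φ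 t p D mk) + ((0 : ℕ) : ℤ)) + ((kgM₂Y (nL κ Φ t p D g f) (ℓL κ Φ t p D g f) (hL κ Φ t p D g f) (vL κ Φ t p D g f) (kgR κ Φ t p D mk) 0 (kgqY κ Φ t p D g f qxY) (kgWY κ Φ t p D g f (KS.WxYR κ Φ t p D mk g f WxY)) (kgNYv0 κ Φ t p D g f mk qxY WxY) : ℕ) : ℤ) * ((kgR κ Φ t p D mk) + ((0 : ℕ) : ℤ) + |vL κ Φ t p D g f|) + (kgR κ Φ t p D mk) + (nL κ Φ t p D g f)))) ≤ (modulus (nL κ Φ t p D g f) (hL κ Φ t p D g f) (vL κ Φ t p D g f) (vβL κ Φ t p D g f)) * ((284 + 12 * ((Neg.Kq κ : ℕ) : ℤ)) * (nL κ Φ t p D g f : ℤ)) := mul_le_mul_of_nonneg_left hB hm.le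
    have h2 : 2 * (((shearUnit (nL κ Φ t p D g f) (hL κ Φ t p D g f) : ℕ)) : ℤ) * (((kgNYv0 κ Φ t p D g f mk qxY WxY : ℕ) : ℤ) + 1) * (nL κ Φ t p D g f : ℤ) ≤ 4 * ((Neg.Kq κ : ℕ) : ℤ) * (modulus (nL κ Φ t p D g f) (hL κ Φ t p D g f) (vL κ Φ t p D g f) (vβL κ Φ t p D g f)) * (nL κ Φ t p D g f : ℤ) := mul_le_mul_of_nonneg_right hNU hn0.le
    linarith only [h1, h2, hUQ]
  have hmn : (0 : ℤ) < (modulus (nL κ Φ t p D g f) (hL κ Φ t p D g f) (vL κ Φ t p D g f) (vβL κ Φ t p D g f)) * (nL κ Φ t p D g f : ℤ) := mul_pos hm hn0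
  have hr0 := hr40 0
  have hr1 := hr40 1
  have hr00 : (0 : ℤ) ≤ (((fcellsA κ Φ t p D g f).r 0 : ℕ) : ℤ) := by positivity
  have hr10 : (0 : ℤ) ≤ (((fcellsA κ Φ t p D g f).r 1 : ℕ) : ℤ) := by positivity
  -- §f the four readings
  have hY0 : rdHi (Aof κ) (nL κ Φ t p D g f) (hL κ Φ t p D g f) (vL κ Φ t p D g f) (vβL κ Φ t p D g f) (prFA κ Φ t p D g f).c₀ (prFA κ Φ t p D g f).c₁ (prFA κ Φ t p D g f).D LO HI 0 ≤ 3 * (((fcellsA κ Φ t p D g f).r 0 : ℕ) : ℤ) - 1 := by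
    refine Skelφ.rdHi_zero_leK (hn := hn1) (hD := hDp) (hm := hm) (hc₀ := hc₀) (hkq := hkq) (hsc0 := hsc0) ?_
    have h1 : (((fcellsA κ Φ t p D g f).r 0 : ℕ) : ℤ) * ((modulus (nL κ Φ t p D g f) (hL κ Φ t p D g f) (vL κ Φ t p D g f) (vβL κ Φ t p D g f)) * HI 0 - min ((vL κ Φ t p D g f) * ((((shearUnit (nL κ Φ t p D g f) (hL κ Φ t p D g f) : ℕ)) : ℤ) * LO 1)) ((vL κ Φ t p D g f) * ((((shearUnit (nL κ Φ t p D g f) (hL κ Φ t p D g f) : ℕ)) : ℤ) * HI 1 + (((shearUnit (nL κ Φ t p D g f) (hL κ Φ t p D g f) : ℕ)) : ℤ) - 1))) ≤ (((fcellsA κ Φ t p D g f).r 0 : ℕ) : ℤ) * ((337 + 19 * ((Neg.Kq κ : ℕ) : ℤ)) * ((modulus (nL κ Φ t p D g f) (hL κ Φ t p D g f) (vL κ Φ t p D g f) (vβL κ Φ t p D g f)) * (nL κ Φ t p D g f : ℤ))) :=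
      mul_le_mul_of_nonneg_left (hpu.trans hS) hr00
    have hA : (168 : ℤ) * (((fcellsA κ Φ t p D g f).r 0 : ℕ) : ℤ) ≤ (101 * ((Neg.Kq κ : ℕ) : ℤ) - 337) * (((fcellsA κ Φ t p D g f).r 0 : ℕ) : ℤ) := mul_le_mul_of_nonneg_right (by linarith only [hkq5]) hr00
    have key : (337 + 19 * ((Neg.Kq κ : ℕ) : ℤ)) * (((fcellsA κ Φ t p D g f).r 0 : ℕ) : ℤ) + 40 * ((Neg.Kq κ : ℕ) : ℤ) < 120 * ((Neg.Kq κ : ℕ) : ℤ) * (((fcellsA κ Φ t p D g f).r 0 : ℕ) : ℤ) := by linarith only [hA, hr0, hkq5]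
    have h2 := mul_lt_mul_of_pos_right key hmn
    linarith only [h1, h2]
  have hX0 : -(3 * (((fcellsA κ Φ t p D g f).r 0 : ℕ) : ℤ)) + 1 ≤ rdLo (Aof κ) (nL κ Φ t p D g f) (hL κ Φ t p D g f) (vL κ Φ t p D g f) (vβL κ Φ t p D g f) (prFA κ Φ t p D g f).c₀ (prFA κ Φ t p D g f).c₁ (prFA κ Φ t p D g f).D LO HI 0 := by
    refine Skelφ.rdLo_zero_geK (hn := hn1) (hA := hA0) (hD := hDp) (hm := hm) (hc₀ := hc₀) (hkq := hkq) (hsc0 := hsc0) ?_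
    have hmX : (0 : ℤ) ≤ (modulus (nL κ Φ t p D g f) (hL κ Φ t p D g f) (vL κ Φ t p D g f) (vβL κ Φ t p D g f)) * (((KS.X2R κ Φ t p D mk g f WxY) : ℕ) : ℤ) := by positivity
    have h1 : (((fcellsA κ Φ t p D g f).r 0 : ℕ) : ℤ) * ((modulus (nL κ Φ t p D g f) (hL κ Φ t p D g f) (vL κ Φ t p D g f) (vβL κ Φ t p D g f)) * ((((KS.X2R κ Φ t p D mk g f WxY) : ℕ) : ℤ) - ((((kgA₁Ym (nL κ Φ t p D g f) (vL κ Φ t p D g f) (kgR κ Φ t p D mk) (kgWY κ Φ t p D g f (KS.WxYR κ Φ t p D mk g f WxY)) (kgNYv0 κ Φ t p D g f mk qxY WxY) : ℕ) : ℤ) + 2 * (nL κ Φ t p D g f) + (kgR κ Φ t p D mk) + ((kgE₁Y (nL κ Φ t p D g f) (vL κ Φ t p D g f) (kgR κ Φ t p D mk) 0 (kgWY κ Φ t p D g f (KS.WxYR κ Φ t p D mk g f WxY)) (kgNYv0 κ Φ t p D g f mk qxY WxY) : ℕ) : ℤ) + ((kgM₂Y (nL κ Φ t p D g f) (ℓL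 κ Φ t p D g f) (hL κ Φ t p D g f) (vL κ Φ t p D g f) (kgR κ Φ t p D mk) 0 (kgqY κ Φ t p D g f qxY) (kgWY κ Φ t p D g f (KS.WxYR κ Φ t p D mk g f WxY)) (kgNYv0 κ Φ t p D g f mk qxY WxY) : ℕ) : ℤ) * ((kgR κ Φ t p D mk) + ((0 : ℕ) : ℤ) + |vL κ Φ t p D g f|)) + (((kgA₁Yp (nL κ Φ t p D g f) (vL κ Φ t p D g f) (kgR κ Φ t p D mk) (kgWY κ Φ t p D g f (KS.WxYR κ Φ t p D mk g f WxY)) (kgNYv0 κ Φ t p D g f mk qxY WxY) : ℕ) : ℤ) + (((kgM₁Y (nL κ Φ t p D g f) (vL κ Φ t p D g f) (kgR κ Φ t p D mk) 0 (kgWY κ Φ t p D g f (KS.WxYR κ Φ t p D mk g f WxY)) (kgNYv0 κ Φ t p D g f mk qxY WxY) : ℕ) : ℤ) + 1) * ((kgR κ Φ t p D mk) + ((0 : ℕ) : ℤ)) + ((kgM₂Y (nL κ Φ t p D g f) (ℓL κ Φ t p D g f) (hL κ Φ t p D g f) (vL κ Φ t p D g f) (kgR κ Φ t p D mk) 0 (kgqY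 κ Φ t p D g f qxY) (kgWY κ Φ t p D g f (KS.WxYR κ Φ t p D mk g f WxY)) (kgNYv0 κ Φ t p D g f mk qxY WxY) : ℕ) : ℤ) * ((kgR κ Φ t p D mk) + ((0 : ℕ) : ℤ) + |vL κ Φ t p D g f|) + (kgR κ Φ t p D mk) + (nL κ Φ t p D g f)))) - 2 * (((shearUnit (nL κ Φ t p D g f) (hL κ Φ t p D g f) : ℕ)) : ℤ) * (((kgNYv0 κ Φ t p D g f mk qxY WxY : ℕ) : ℤ) + 1) * (nL κ Φ t p D g f : ℤ) - (nL κ Φ t p D g f : ℤ) * ((((shearUnit (nL κ Φ t p D g f) (hL κ Φ t p D g f) : ℕ)) : ℤ) * ((((kgqY κ Φ t p D g f qxY : ℕ) : ℤ) + (((kgNYv0 κ Φ t p D g f mk qxY WxY : ℕ) : ℤ) + 1) * (kgR κ Φ t p D mk) + (((kgM₁Y (nL κ Φ t p D g f) (vL κ Φ t p D g f) (kgR κ Φ t p D mk) 0 (kgWY κ Φ t p D g f (KS.WxYR κ Φ t p D mk g f WxY)) (kgNYv0 κ Φ t p D g f mk qxY WxY) : ℕ) : ℤ) + 1) * ((kgR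 κ Φ t p D mk) + ((0 : ℕ) : ℤ)) + ((nL κ Φ t p D g f : ℤ) * ℓL κ Φ t p D g f / (shearUnit (nL κ Φ t p D g f) (hL κ Φ t p D g f) : ℕ) + 1) + (kgR κ Φ t p D mk) + ((3 * (nL κ Φ t p D g f * ℓL κ Φ t p D g f) / shearUnit (nL κ Φ t p D g f) (hL κ Φ t p D g f) + 1 : ℕ) : ℤ)) + (((kgqY κ Φ t p D g f qxY : ℕ) : ℤ) + (((kgNYv0 κ Φ t p D g f mk qxY WxY : ℕ) : ℤ) + 1) * (kgR κ Φ t p D mk) + (((kgM₁Y (nL κ Φ t p D g f) (vL κ Φ t p D g f) (kgR κ Φ t p D mk) 0 (kgWY κ Φ t p D g f (KS.WxYR κ Φ t p D mk g f WxY)) (kgNYv0 κ Φ t p D g f mk qxY WxY) : ℕ) : ℤ) + 1) * ((kgR κ Φ t p D mk) + ((0 : ℕ) : ℤ)) + ((kgM₂Y (nL κ Φ t p D g f) (ℓL κ Φ t p D g f) (hL κ Φ t p D g f) (vL κ Φ t p D g f) (kgR κ Φ t p D mk) 0 (kgqY κ Φ t p D g f qxY) (kgWY κ Φ t p D g f (KS.WxYR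 κ Φ t p D mk g f WxY)) (kgNYv0 κ Φ t p D g f mk qxY WxY) : ℕ) : ℤ) * ((kgR κ Φ t p D mk) + ((0 : ℕ) : ℤ)) + (kgR κ Φ t p D mk) + ((3 * (nL κ Φ t p D g f * ℓL κ Φ t p D g f) / shearUnit (nL κ Φ t p D g f) (hL κ Φ t p D g f) + 1 : ℕ) : ℤ)) + 1) + (((shearUnit (nL κ Φ t p D g f) (hL κ Φ t p D g f) : ℕ)) : ℤ))) ≤ (((fcellsA κ Φ t p D g f).r 0 : ℕ) : ℤ) * ((modulus (nL κ Φ t p D g f) (hL κ Φ t p D g f) (vL κ Φ t p D g f) (vβL κ Φ t p D g f)) * LO 0 - max ((vL κ Φ t p D g f) * ((((shearUnit (nL κ Φ t p D g f) (hL κ Φ t p D g f) : ℕ)) : ℤ) * LO 1)) ((vL κ Φ t p D g f) * ((((shearUnit (nL κ Φ t p D g f) (hL κ Φ t p D g f) : ℕ)) : ℤ) * HI 1 + (((shearUnit (nL κ Φ t p D g f) (hL κ Φ t p D g f) : ℕ)) : ℤ) - 1))) :=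
      mul_le_mul_of_nonneg_left hpl hr00
    have h3 : -((338 + 19 * ((Neg.Kq κ : ℕ) : ℤ)) * ((modulus (nL κ Φ t p D g f) (hL κ Φ t p D g f) (vL κ Φ t p D g f) (vβL κ Φ t p D g f)) * (nL κ Φ t p D g f : ℤ)) - (nL κ Φ t p D g f : ℤ)) ≤ (modulus (nL κ Φ t p D g f) (hL κ Φ t p D g f) (vL κ Φ t p D g f) (vβL κ Φ t p D g f)) * ((((KS.X2R κ Φ t p D mk g f WxY) : ℕ) : ℤ) - ((((kgA₁Ym (nL κ Φ t p D g f) (vL κ Φ t p D g f) (kgR κ Φ t p D mk) (kgWY κ Φ t p D g f (KS.WxYR κ Φ t p D mk g f WxY)) (kgNYv0 κ Φ t p D g f mk qxY WxY) : ℕ) : ℤ) + 2 * (nL κ Φ t p D g f) + (kgR κ Φ t p D mk) + ((kgE₁Y (nL κ Φ t p D g f) (vL κ Φ t p D g f) (kgR κ Φ t p D mk) 0 (kgWY κ Φ t p D g f (KS.WxYR κ Φ t p D mk g f WxY)) (kgNYv0 κ Φ t p D g f mk qxY WxY) : ℕ) : ℤ) + ((kgM₂Y (nL κ Φ t p D g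 f) (ℓL κ Φ t p D g f) (hL κ Φ t p D g f) (vL κ Φ t p D g f) (kgR κ Φ t p D mk) 0 (kgqY κ Φ t p D g f qxY) (kgWY κ Φ t p D g f (KS.WxYR κ Φ t p D mk g f WxY)) (kgNYv0 κ Φ t p D g f mk qxY WxY) : ℕ) : ℤ) * ((kgR κ Φ t p D mk) + ((0 : ℕ) : ℤ) + |vL κ Φ t p D g f|)) + (((kgA₁Yp (nL κ Φ t p D g f) (vL κ Φ t p D g f) (kgR κ Φ t p D mk) (kgWY κ Φ t p D g f (KS.WxYR κ Φ t p D mk g f WxY)) (kgNYv0 κ Φ t p D g f mk qxY WxY) : ℕ) : ℤ) + (((kgM₁Y (nL κ Φ t p D g f) (vL κ Φ t p D g f) (kgR κ Φ t p D mk) 0 (kgWY κ Φ t p D g f (KS.WxYR κ Φ t p D mk g f WxY)) (kgNYv0 κ Φ t p D g f mk qxY WxY) : ℕ) : ℤ) + 1) * ((kgR κ Φ t p D mk) + ((0 : ℕ) : ℤ)) + ((kgM₂Y (nL κ Φ t p D g f) (ℓL κ Φ t p D g f) (hL κ Φ t p D g f) (vL κ Φ t p D g f) (kgR κ Φ t p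 D mk) 0 (kgqY κ Φ t p D g f qxY) (kgWY κ Φ t p D g f (KS.WxYR κ Φ t p D mk g f WxY)) (kgNYv0 κ Φ t p D g f mk qxY WxY) : ℕ) : ℤ) * ((kgR κ Φ t p D mk) + ((0 : ℕ) : ℤ) + |vL κ Φ t p D g f|) + (kgR κ Φ t p D mk) + (nL κ Φ t p D g f)))) - 2 * (((shearUnit (nL κ Φ t p D g f) (hL κ Φ t p D g f) : ℕ)) : ℤ) * (((kgNYv0 κ Φ t p D g f mk qxY WxY : ℕ) : ℤ) + 1) * (nL κ Φ t p D g f : ℤ) - (nL κ Φ t p D g f : ℤ) * ((((shearUnit (nL κ Φ t p D g f) (hL κ Φ t p D g f) : ℕ)) : ℤ) * ((((kgqY κ Φ t p D g f qxY : ℕ) : ℤ) + (((kgNYv0 κ Φ t p D g f mk qxY WxY : ℕ) : ℤ) + 1) * (kgR κ Φ t p D mk) + (((kgM₁Y (nL κ Φ t p D g f) (vL κ Φ t p D g f) (kgR κ Φ t p D mk) 0 (kgWY κ Φ t p D g f (KS.WxYR κ Φ t p D mk g f WxY)) (kgNYv0 κ Φ t p D g f mk qxY WxY) : ℕ) : ℤ)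 + 1) * ((kgR κ Φ t p D mk) + ((0 : ℕ) : ℤ)) + ((nL κ Φ t p D g f : ℤ) * ℓL κ Φ t p D g f / (shearUnit (nL κ Φ t p D g f) (hL κ Φ t p D g f) : ℕ) + 1) + (kgR κ Φ t p D mk) + ((3 * (nL κ Φ t p D g f * ℓL κ Φ t p D g f) / shearUnit (nL κ Φ t p D g f) (hL κ Φ t p D g f) + 1 : ℕ) : ℤ)) + (((kgqY κ Φ t p D g f qxY : ℕ) : ℤ) + (((kgNYv0 κ Φ t p D g f mk qxY WxY : ℕ) : ℤ) + 1) * (kgR κ Φ t p D mk) + (((kgM₁Y (nL κ Φ t p D g f) (vL κ Φ t p D g f) (kgR κ Φ t p D mk) 0 (kgWY κ Φ t p D g f (KS.WxYR κ Φ t p D mk g f WxY)) (kgNYv0 κ Φ t p D g f mk qxY WxY) : ℕ) : ℤ) + 1) * ((kgR κ Φ t p D mk) + ((0 : ℕ) : ℤ)) + ((kgM₂Y (nL κ Φ t p D g f) (ℓL κ Φ t p D g f) (hL κ Φ t p D g f) (vL κ Φ t p D g f) (kgR κ Φ t p D mk) 0 (kgqY κ Φ t p D g f qxY) (kgWY κ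 Φ t p D g f (KS.WxYR κ Φ t p D mk g f WxY)) (kgNYv0 κ Φ t p D g f mk qxY WxY) : ℕ) : ℤ) * ((kgR κ Φ t p D mk) + ((0 : ℕ) : ℤ)) + (kgR κ Φ t p D mk) + ((3 * (nL κ Φ t p D g f * ℓL κ Φ t p D g f) / shearUnit (nL κ Φ t p D g f) (hL κ Φ t p D g f) + 1 : ℕ) : ℤ)) + 1) + (((shearUnit (nL κ Φ t p D g f) (hL κ Φ t p D g f) : ℕ)) : ℤ)) := by
      linarith only [hS, hmX, hnmn]
    have h2 := mul_le_mul_of_nonneg_left h3 hr00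
    have hA : (167 : ℤ) * (((fcellsA κ Φ t p D g f).r 0 : ℕ) : ℤ) ≤ (101 * ((Neg.Kq κ : ℕ) : ℤ) - 338) * (((fcellsA κ Φ t p D g f).r 0 : ℕ) : ℤ) := mul_le_mul_of_nonneg_right (by linarith only [hkq5]) hr00
    have key : (338 + 19 * ((Neg.Kq κ : ℕ) : ℤ)) * (((fcellsA κ Φ t p D g f).r 0 : ℕ) : ℤ) + 40 * ((Neg.Kq κ : ℕ) : ℤ) ≤ 120 * ((Neg.Kq κ : ℕ) : ℤ) * (((fcellsA κ Φ t p D g f).r 0 : ℕ) : ℤ) := by linarith only [hA, hr0, hkq5]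
    have h4 := mul_le_mul_of_nonneg_right key hmn.le
    linarith only [h1, h2, h4]
  have hY1 : rdHi (Aof κ) (nL κ Φ t p D g f) (hL κ Φ t p D g f) (vL κ Φ t p D g f) (vβL κ Φ t p D g f) (prFA κ Φ t p D g f).c₀ (prFA κ Φ t p D g f).c₁ (prFA κ Φ t p D g f).D LO HI 1 ≤ 25 * (((fcellsA κ Φ t p D g f).r 1 : ℕ) : ℤ) - 1 := by
    refine Skelφ.rdHi_one_leK (hD := hDp) (hm := hm) (hkq := hkq) (hsc1 := hsc1) ?_
    rw [eH1]
    have hsHi0 : (0 : ℤ) ≤ ((nL κ Φ t p D g f : ℤ) * ℓL κ Φ t p D g f / (shearUnit (nL κ Φ t p D g f) (hL κ Φ t p D g f) : ℕ) + 1) := by linarith only [hsHi1]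
    have h1 : (k : ℤ) * ((nL κ Φ t p D g f : ℤ) * ℓL κ Φ t p D g f / (shearUnit (nL κ Φ t p D g f) (hL κ Φ t p D g f) : ℕ) + 1) ≤ (((kgNYv0 κ Φ t p D g f mk qxY WxY : ℕ) : ℤ) + 1) * ((nL κ Φ t p D g f : ℤ) * ℓL κ Φ t p D g f / (shearUnit (nL κ Φ t p D g f) (hL κ Φ t p D g f) : ℕ) + 1) := mul_le_mul_of_nonneg_right hkN' hsHi0
    have h1' : (((shearUnit (nL κ Φ t p D g f) (hL κ Φ t p D g f) : ℕ)) : ℤ) * ((k : ℤ) * ((nL κ Φ t p D g f : ℤ) * ℓL κ Φ t p D g f / (shearUnit (nL κ Φ t p D g f) (hL κ Φ t p D g f) : ℕ) + 1)) ≤ (((shearUnit (nL κ Φ t p D g f) (hL κ Φ t p D g f) : ℕ)) : ℤ) * ((((kgNYv0 κ Φ t p D g f mk qxY WxY : ℕ) : ℤ) + 1) * ((nL κ Φ t p D g f : ℤ) * ℓL κ Φ t p D g f / (shearUnit (nL κ Φ t p D g f) (hL κ Φ t p D g f) : ℕ) + 1)) := mul_le_mul_of_nonneg_left h1 hU0.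le
    have h2 : (((shearUnit (nL κ Φ t p D g f) (hL κ Φ t p D g f) : ℕ)) : ℤ) * ((((kgNYv0 κ Φ t p D g f mk qxY WxY : ℕ) : ℤ) + 1) * ((nL κ Φ t p D g f : ℤ) * ℓL κ Φ t p D g f / (shearUnit (nL κ Φ t p D g f) (hL κ Φ t p D g f) : ℕ) + 1)) ≤ (((kgNYv0 κ Φ t p D g f mk qxY WxY : ℕ) : ℤ) + 1) * ((modulus (nL κ Φ t p D g f) (hL κ Φ t p D g f) (vL κ Φ t p D g f) (vβL κ Φ t p D g f)) + 2 * (((shearUnit (nL κ Φ t p D g f) (hL κ Φ t p D g f) : ℕ)) : ℤ)) := by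
      have h0 := mul_le_mul_of_nonneg_left (show (((shearUnit (nL κ Φ t p D g f) (hL κ Φ t p D g f) : ℕ)) : ℤ) * ((nL κ Φ t p D g f : ℤ) * ℓL κ Φ t p D g f / (shearUnit (nL κ Φ t p D g f) (hL κ Φ t p D g f) : ℕ) + 1) ≤ (modulus (nL κ Φ t p D g f) (hL κ Φ t p D g f) (vL κ Φ t p D g f) (vβL κ Φ t p D g f)) + 2 * (((shearUnit (nL κ Φ t p D g f) (hL κ Φ t p D g f) : ℕ)) : ℤ) by linarith only [hmσ3])
        (show (0 : ℤ) ≤ ((kgNYv0 κ Φ t p D g f mk qxY WxY : ℕ) : ℤ) + 1 by positivity)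
      linarith only [h0]
    have h3 : (((kgNYv0 κ Φ t p D g f mk qxY WxY : ℕ) : ℤ) + 1) * (modulus (nL κ Φ t p D g f) (hL κ Φ t p D g f) (vL κ Φ t p D g f) (vβL κ Φ t p D g f)) ≤ (840 * ((Neg.Kq κ : ℕ) : ℤ) + 3) * (modulus (nL κ Φ t p D g f) (hL κ Φ t p D g f) (vL κ Φ t p D g f) (vβL κ Φ t p D g f)) := mul_le_mul_of_nonneg_right hNK hm.le
    have h5 : (((shearUnit (nL κ Φ t p D g f) (hL κ Φ t p D g f) : ℕ)) : ℤ) * ((k : ℤ) * ((nL κ Φ t p D g f : ℤ) * ℓL κ Φ t p D g f / (shearUnit (nL κ Φ t p D g f) (hL κ Φ t p D g f) : ℕ) + 1) + (((kgqY κ Φ t p D g f qxY : ℕ) : ℤ) + (((kgNYv0 κ Φ t p D g f mk qxY WxY : ℕ) : ℤ) + 1) * (kgR κ Φ t p D mk) + (((kgM₁Y (nL κ Φ t p D g f) (vL κ Φ t p D g f) (kgR κ Φ t p D mk) 0 (kgWY κ Φ t p D g f (KS.WxYR κ Φ t p D mk g f WxY)) (kgNYv0 κ Φ t p D g f mk qxY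 WxY) : ℕ) : ℤ) + 1) * ((kgR κ Φ t p D mk) + ((0 : ℕ) : ℤ)) + ((kgM₂Y (nL κ Φ t p D g f) (ℓL κ Φ t p D g f) (hL κ Φ t p D g f) (vL κ Φ t p D g f) (kgR κ Φ t p D mk) 0 (kgqY κ Φ t p D g f qxY) (kgWY κ Φ t p D g f (KS.WxYR κ Φ t p D mk g f WxY)) (kgNYv0 κ Φ t p D g f mk qxY WxY) : ℕ) : ℤ) * ((kgR κ Φ t p D mk) + ((0 : ℕ) : ℤ)) + (kgR κ Φ t p D mk) + ((3 * (nL κ Φ t p D g f * ℓL κ Φ t p D g f) / shearUnit (nL κ Φ t p D g f) (hL κ Φ t p D g f) + 1 : ℕ) : ℤ)) + 1) + (((shearUnit (nL κ Φ t p D g f) (hL κ Φ t p D g f) : ℕ)) : ℤ) - 1 ≤ (847 * ((Neg.Kq κ : ℕ) : ℤ) + 56) * (modulus (nL κ Φ t p D g f) (hL κ Φ t p D g f) (vL κ Φ t p D g f) (vβL κ Φ t p D g f)) := by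
      have h6 : (((shearUnit (nL κ Φ t p D g f) (hL κ Φ t p D g f) : ℕ)) : ℤ) * ((((kgqY κ Φ t p D g f qxY : ℕ) : ℤ) + (((kgNYv0 κ Φ t p D g f mk qxY WxY : ℕ) : ℤ) + 1) * (kgR κ Φ t p D mk) + (((kgM₁Y (nL κ Φ t p D g f) (vL κ Φ t p D g f) (kgR κ Φ t p D mk) 0 (kgWY κ Φ t p D g f (KS.WxYR κ Φ t p D mk g f WxY)) (kgNYv0 κ Φ t p D g f mk qxY WxY) : ℕ) : ℤ) + 1) * ((kgR κ Φ t p D mk) + ((0 : ℕ) : ℤ)) + ((kgM₂Y (nL κ Φ t p D g f) (ℓL κ Φ t p D g f) (hL κ Φ t p D g f) (vL κ Φ t p D g f) (kgR κ Φ t p D mk) 0 (kgqY κ Φ t p D g f qxY) (kgWY κ Φ t p D g f (KS.WxYR κ Φ t p D mk g f WxY)) (kgNYv0 κ Φ t p D g f mk qxY WxY) : ℕ) : ℤ) * ((kgR κ Φ t p D mk) + ((0 : ℕ) : ℤ)) + (kgR κ Φ t p D mk) + ((3 * (nL κ Φ t p D g f * ℓL κ Φ t p D g f) / shearUnit (nL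 κ Φ t p D g f) (hL κ Φ t p D g f) + 1 : ℕ) : ℤ)) + 2) ≤ (((shearUnit (nL κ Φ t p D g f) (hL κ Φ t p D g f) : ℕ)) : ℤ) * ((((kgqY κ Φ t p D g f qxY : ℕ) : ℤ) + (((kgNYv0 κ Φ t p D g f mk qxY WxY : ℕ) : ℤ) + 1) * (kgR κ Φ t p D mk) + (((kgM₁Y (nL κ Φ t p D g f) (vL κ Φ t p D g f) (kgR κ Φ t p D mk) 0 (kgWY κ Φ t p D g f (KS.WxYR κ Φ t p D mk g f WxY)) (kgNYv0 κ Φ t p D g f mk qxY WxY) : ℕ) : ℤ) + 1) * ((kgR κ Φ t p D mk) + ((0 : ℕ) : ℤ)) + ((nL κ Φ t p D g f : ℤ) * ℓL κ Φ t p D g f / (shearUnit (nL κ Φ t p D g f) (hL κ Φ t p D g f) : ℕ) + 1) + (kgR κ Φ t p D mk) + ((3 * (nL κ Φ t p D g f * ℓL κ Φ t p D g f) / shearUnit (nL κ Φ t p D g f) (hL κ Φ t p D g f) + 1 : ℕ) : ℤ)) + (((kgqY κ Φ t p D g f qxY : ℕ) : ℤ) + (((kgNYv0 κ Φ t p D g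 f mk qxY WxY : ℕ) : ℤ) + 1) * (kgR κ Φ t p D mk) + (((kgM₁Y (nL κ Φ t p D g f) (vL κ Φ t p D g f) (kgR κ Φ t p D mk) 0 (kgWY κ Φ t p D g f (KS.WxYR κ Φ t p D mk g f WxY)) (kgNYv0 κ Φ t p D g f mk qxY WxY) : ℕ) : ℤ) + 1) * ((kgR κ Φ t p D mk) + ((0 : ℕ) : ℤ)) + ((kgM₂Y (nL κ Φ t p D g f) (ℓL κ Φ t p D g f) (hL κ Φ t p D g f) (vL κ Φ t p D g f) (kgR κ Φ t p D mk) 0 (kgqY κ Φ t p D g f qxY) (kgWY κ Φ t p D g f (KS.WxYR κ Φ t p D mk g f WxY)) (kgNYv0 κ Φ t p D g f mk qxY WxY) : ℕ) : ℤ) * ((kgR κ Φ t p D mk) + ((0 : ℕ) : ℤ)) + (kgR κ Φ t p D mk) + ((3 * (nL κ Φ t p D g f * ℓL κ Φ t p D g f) / shearUnit (nL κ Φ t p D g f) (hL κ Φ t p D g f) + 1 : ℕ) : ℤ)) + 2) := mul_le_mul_of_nonneg_left (by linarith only [hQm0]) hU0.le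
      linarith only [h1', h2, h3, hNU, h6, hUQ3]
    have hA : (97 : ℤ) * (((fcellsA κ Φ t p D g f).r 1 : ℕ) : ℤ) ≤ (153 * ((Neg.Kq κ : ℕ) : ℤ) - 56) * (((fcellsA κ Φ t p D g f).r 1 : ℕ) : ℤ) := mul_le_mul_of_nonneg_right (by linarith only [hkq5]) hr10
    have key : (847 * ((Neg.Kq κ : ℕ) : ℤ) + 56) * (((fcellsA κ Φ t p D g f).r 1 : ℕ) : ℤ) + 40 * ((Neg.Kq κ : ℕ) : ℤ) < 1000 * ((Neg.Kq κ : ℕ) : ℤ) * (((fcellsA κ Φ t p D g f).r 1 : ℕ) : ℤ) := by linarith only [hA, hr1, hkq5]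
    have h6 := mul_lt_mul_of_pos_right key hm
    have h7 : (((fcellsA κ Φ t p D g f).r 1 : ℕ) : ℤ) * ((((shearUnit (nL κ Φ t p D g f) (hL κ Φ t p D g f) : ℕ)) : ℤ) * ((k : ℤ) * ((nL κ Φ t p D g f : ℤ) * ℓL κ Φ t p D g f / (shearUnit (nL κ Φ t p D g f) (hL κ Φ t p D g f) : ℕ) + 1) + (((kgqY κ Φ t p D g f qxY : ℕ) : ℤ) + (((kgNYv0 κ Φ t p D g f mk qxY WxY : ℕ) : ℤ) + 1) * (kgR κ Φ t p D mk) + (((kgM₁Y (nL κ Φ t p D g f) (vL κ Φ t p D g f) (kgR κ Φ t p D mk) 0 (kgWY κ Φ t p D g f (KS.WxYR κ Φ t p D mk g f WxY)) (kgNYv0 κ Φ t p D g f mk qxY WxY) : ℕ) : ℤ) + 1) * ((kgR κ Φ t p D mk) + ((0 : ℕ) : ℤ)) + ((kgM₂Y (nL κ Φ t p D g f) (ℓL κ Φ t p D g f) (hL κ Φ t p D g f) (vL κ Φ t p D g f) (kgR κ Φ t p D mk) 0 (kgqY κ Φ t p D g f qxY) (kgWY κ Φ t p D g f (KS.WxYR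 κ Φ t p D mk g f WxY)) (kgNYv0 κ Φ t p D g f mk qxY WxY) : ℕ) : ℤ) * ((kgR κ Φ t p D mk) + ((0 : ℕ) : ℤ)) + (kgR κ Φ t p D mk) + ((3 * (nL κ Φ t p D g f * ℓL κ Φ t p D g f) / shearUnit (nL κ Φ t p D g f) (hL κ Φ t p D g f) + 1 : ℕ) : ℤ)) + 1) + (((shearUnit (nL κ Φ t p D g f) (hL κ Φ t p D g f) : ℕ)) : ℤ) - 1) ≤ (((fcellsA κ Φ t p D g f).r 1 : ℕ) : ℤ) * ((847 * ((Neg.Kq κ : ℕ) : ℤ) + 56) * (modulus (nL κ Φ t p D g f) (hL κ Φ t p D g f) (vL κ Φ t p D g f) (vβL κ Φ t p D g f))) :=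
      mul_le_mul_of_nonneg_left h5 hr10
    linarith only [h7, h6]
  have hX1 : -(5 * (((fcellsA κ Φ t p D g f).r 1 : ℕ) : ℤ)) + 1 ≤ rdLo (Aof κ) (nL κ Φ t p D g f) (hL κ Φ t p D g f) (vL κ Φ t p D g f) (vβL κ Φ t p D g f) (prFA κ Φ t p D g f).c₀ (prFA κ Φ t p D g f).c₁ (prFA κ Φ t p D g f).D LO HI 1 := by
    refine Skelφ.rdLo_one_geK (hD := hDp) (hm := hm) (hkq := hkq) (hsc1 := hsc1) ?_
    rw [eL1]
    have h1 : (0 : ℤ) ≤ (k : ℤ) * (((nL κ Φ t p D g f : ℤ) * ℓL κ Φ t p D g f - (shearUnit (nL κ Φ t p D g f) (hL κ Φ t p D g f) : ℕ) + 1) / (shearUnit (nL κ Φ t p D g f) (hL κ Φ t p D g f) : ℕ)) := by rw [← eσ]; exact mul_nonneg hk0 hσ0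
    have h1' : (0 : ℤ) ≤ (((shearUnit (nL κ Φ t p D g f) (hL κ Φ t p D g f) : ℕ)) : ℤ) * ((k : ℤ) * (((nL κ Φ t p D g f : ℤ) * ℓL κ Φ t p D g f - (shearUnit (nL κ Φ t p D g f) (hL κ Φ t p D g f) : ℕ) + 1) / (shearUnit (nL κ Φ t p D g f) (hL κ Φ t p D g f) : ℕ))) := mul_nonneg hU0.le h1
    have h4 : (((shearUnit (nL κ Φ t p D g f) (hL κ Φ t p D g f) : ℕ)) : ℤ) * (((kgqY κ Φ t p D g f qxY : ℕ) : ℤ) + (((kgNYv0 κ Φ t p D g f mk qxY WxY : ℕ) : ℤ) + 1) * (kgR κ Φ t p D mk) + (((kgM₁Y (nL κ Φ t p D g f) (vL κ Φ t p D g f) (kgR κ Φ t p D mk) 0 (kgWY κ Φ t p D g f (KS.WxYR κ Φ t p D mk g f WxY)) (kgNYv0 κ Φ t p D g f mk qxY WxY) : ℕ) : ℤ) + 1) * ((kgR κ Φ t p D mk) + ((0 : ℕ) : ℤ)) + ((nL κ Φ t p D g f : ℤ) * ℓL κ Φ t p D g f / (shearUnit (nL κ Φ t p D g f) (hL κ Φ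 t p D g f) : ℕ) + 1) + (kgR κ Φ t p D mk) + ((3 * (nL κ Φ t p D g f * ℓL κ Φ t p D g f) / shearUnit (nL κ Φ t p D g f) (hL κ Φ t p D g f) + 1 : ℕ) : ℤ)) ≤ (53 + 3 * ((Neg.Kq κ : ℕ) : ℤ)) * (modulus (nL κ Φ t p D g f) (hL κ Φ t p D g f) (vL κ Φ t p D g f) (vβL κ Φ t p D g f)) := by
      have h6 : (((shearUnit (nL κ Φ t p D g f) (hL κ Φ t p D g f) : ℕ)) : ℤ) * (((kgqY κ Φ t p D g f qxY : ℕ) : ℤ) + (((kgNYv0 κ Φ t p D g f mk qxY WxY : ℕ) : ℤ) + 1) * (kgR κ Φ t p D mk) + (((kgM₁Y (nL κ Φ t p D g f) (vL κ Φ t p D g f) (kgR κ Φ t p D mk) 0 (kgWY κ Φ t p D g f (KS.WxYR κ Φ t p D mk g f WxY)) (kgNYv0 κ Φ t p D g f mk qxY WxY) : ℕ) : ℤ) + 1) * ((kgR κ Φ t p D mk) + ((0 : ℕ) : ℤ)) + ((nL κ Φ t p D g f : ℤ) * ℓL κ Φ t p D g f / (shearUnit (nL κ Φ t p D g f) (hL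 κ Φ t p D g f) : ℕ) + 1) + (kgR κ Φ t p D mk) + ((3 * (nL κ Φ t p D g f * ℓL κ Φ t p D g f) / shearUnit (nL κ Φ t p D g f) (hL κ Φ t p D g f) + 1 : ℕ) : ℤ)) ≤ (((shearUnit (nL κ Φ t p D g f) (hL κ Φ t p D g f) : ℕ)) : ℤ) * ((((kgqY κ Φ t p D g f qxY : ℕ) : ℤ) + (((kgNYv0 κ Φ t p D g f mk qxY WxY : ℕ) : ℤ) + 1) * (kgR κ Φ t p D mk) + (((kgM₁Y (nL κ Φ t p D g f) (vL κ Φ t p D g f) (kgR κ Φ t p D mk) 0 (kgWY κ Φ t p D g f (KS.WxYR κ Φ t p D mk g f WxY)) (kgNYv0 κ Φ t p D g f mk qxY WxY) : ℕ) : ℤ) + 1) * ((kgR κ Φ t p D mk) + ((0 : ℕ) : ℤ)) + ((nL κ Φ t p D g f : ℤ) * ℓL κ Φ t p D g f / (shearUnit (nL κ Φ t p D g f) (hL κ Φ t p D g f) : ℕ) + 1) + (kgR κ Φ t p D mk) + ((3 * (nL κ Φ t p D g f * ℓL κ Φ t p D g f) / shearUnit (nL κ Φ t p D g f) (hL κ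 Φ t p D g f) + 1 : ℕ) : ℤ)) + (((kgqY κ Φ t p D g f qxY : ℕ) : ℤ) + (((kgNYv0 κ Φ t p D g f mk qxY WxY : ℕ) : ℤ) + 1) * (kgR κ Φ t p D mk) + (((kgM₁Y (nL κ Φ t p D g f) (vL κ Φ t p D g f) (kgR κ Φ t p D mk) 0 (kgWY κ Φ t p D g f (KS.WxYR κ Φ t p D mk g f WxY)) (kgNYv0 κ Φ t p D g f mk qxY WxY) : ℕ) : ℤ) + 1) * ((kgR κ Φ t p D mk) + ((0 : ℕ) : ℤ)) + ((kgM₂Y (nL κ Φ t p D g f) (ℓL κ Φ t p D g f) (hL κ Φ t p D g f) (vL κ Φ t p D g f) (kgR κ Φ t p D mk) 0 (kgqY κ Φ t p D g f qxY) (kgWY κ Φ t p D g f (KS.WxYR κ Φ t p D mk g f WxY)) (kgNYv0 κ Φ t p D g f mk qxY WxY) : ℕ) : ℤ) * ((kgR κ Φ t p D mk) + ((0 : ℕ) : ℤ)) + (kgR κ Φ t p D mk) + ((3 * (nL κ Φ t p D g f * ℓL κ Φ t p D g f) / shearUnit (nL κ Φ t p D g f) (hL κ Φ t p D g f) + 1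 : ℕ) : ℤ)) + 2) := mul_le_mul_of_nonneg_left (by linarith only [hQp0]) hU0.le
      linarith only [h6, hUQ3]
    have h5 : -((53 + 3 * ((Neg.Kq κ : ℕ) : ℤ)) * (modulus (nL κ Φ t p D g f) (hL κ Φ t p D g f) (vL κ Φ t p D g f) (vβL κ Φ t p D g f))) ≤ (((shearUnit (nL κ Φ t p D g f) (hL κ Φ t p D g f) : ℕ)) : ℤ) * ((k : ℤ) * (((nL κ Φ t p D g f : ℤ) * ℓL κ Φ t p D g f - (shearUnit (nL κ Φ t p D g f) (hL κ Φ t p D g f) : ℕ) + 1) / (shearUnit (nL κ Φ t p D g f) (hL κ Φ t p D g f) : ℕ)) - (((kgqY κ Φ t p D g f qxY : ℕ) : ℤ) + (((kgNYv0 κ Φ t p D g f mk qxY WxY : ℕ) : ℤ) + 1) * (kgR κ Φ t p D mk) + (((kgM₁Y (nL κ Φ t p D g f) (vL κ Φ t p D g f) (kgR κ Φ t p D mk) 0 (kgWY κ Φ t p D g f (KS.WxYR κ Φ t p D mk g f WxY)) (kgNYv0 κ Φ t p D g f mk qxY WxY) : ℕ) : ℤ) + 1) * ((kgR κ Φ t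 p D mk) + ((0 : ℕ) : ℤ)) + ((nL κ Φ t p D g f : ℤ) * ℓL κ Φ t p D g f / (shearUnit (nL κ Φ t p D g f) (hL κ Φ t p D g f) : ℕ) + 1) + (kgR κ Φ t p D mk) + ((3 * (nL κ Φ t p D g f * ℓL κ Φ t p D g f) / shearUnit (nL κ Φ t p D g f) (hL κ Φ t p D g f) + 1 : ℕ) : ℤ)) + 0) := by
      have e : (((shearUnit (nL κ Φ t p D g f) (hL κ Φ t p D g f) : ℕ)) : ℤ) * ((k : ℤ) * (((nL κ Φ t p D g f : ℤ) * ℓL κ Φ t p D g f - (shearUnit (nL κ Φ t p D g f) (hL κ Φ t p D g f) : ℕ) + 1) / (shearUnit (nL κ Φ t p D g f) (hL κ Φ t p D g f) : ℕ)) - (((kgqY κ Φ t p D g f qxY : ℕ) : ℤ) + (((kgNYv0 κ Φ t p D g f mk qxY WxY : ℕ) : ℤ) + 1) * (kgR κ Φ t p D mk) + (((kgM₁Y (nL κ Φ t p D g f) (vL κ Φ t p D g f) (kgR κ Φ t p D mk) 0 (kgWY κ Φ t p D g f (KS.WxYR κ Φ t p D mk g f WxY)) (kgNYv0 κ Φ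 t p D g f mk qxY WxY) : ℕ) : ℤ) + 1) * ((kgR κ Φ t p D mk) + ((0 : ℕ) : ℤ)) + ((nL κ Φ t p D g f : ℤ) * ℓL κ Φ t p D g f / (shearUnit (nL κ Φ t p D g f) (hL κ Φ t p D g f) : ℕ) + 1) + (kgR κ Φ t p D mk) + ((3 * (nL κ Φ t p D g f * ℓL κ Φ t p D g f) / shearUnit (nL κ Φ t p D g f) (hL κ Φ t p D g f) + 1 : ℕ) : ℤ)) + 0) = (((shearUnit (nL κ Φ t p D g f) (hL κ Φ t p D g f) : ℕ)) : ℤ) * ((k : ℤ) * (((nL κ Φ t p D g f : ℤ) * ℓL κ Φ t p D g f - (shearUnit (nL κ Φ t p D g f) (hL κ Φ t p D g f) : ℕ) + 1) / (shearUnit (nL κ Φ t p D g f) (hL κ Φ t p D g f) : ℕ))) - (((shearUnit (nL κ Φ t p D g f) (hL κ Φ t p D g f) : ℕ)) : ℤ) * (((kgqY κ Φ t p D g f qxY : ℕ) : ℤ) + (((kgNYv0 κ Φ t p D g f mk qxY WxY : ℕ) : ℤ) + 1) * (kgR κ Φ t p D mk) + (((kgM₁Y (nL κ Φ t p D g f)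 (vL κ Φ t p D g f) (kgR κ Φ t p D mk) 0 (kgWY κ Φ t p D g f (KS.WxYR κ Φ t p D mk g f WxY)) (kgNYv0 κ Φ t p D g f mk qxY WxY) : ℕ) : ℤ) + 1) * ((kgR κ Φ t p D mk) + ((0 : ℕ) : ℤ)) + ((nL κ Φ t p D g f : ℤ) * ℓL κ Φ t p D g f / (shearUnit (nL κ Φ t p D g f) (hL κ Φ t p D g f) : ℕ) + 1) + (kgR κ Φ t p D mk) + ((3 * (nL κ Φ t p D g f * ℓL κ Φ t p D g f) / shearUnit (nL κ Φ t p D g f) (hL κ Φ t p D g f) + 1 : ℕ) : ℤ)) := by ring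
      rw [e]; linarith only [h1', h4]
    have hA : (144 : ℤ) * (((fcellsA κ Φ t p D g f).r 1 : ℕ) : ℤ) ≤ (197 * ((Neg.Kq κ : ℕ) : ℤ) - 53) * (((fcellsA κ Φ t p D g f).r 1 : ℕ) : ℤ) := mul_le_mul_of_nonneg_right (by linarith only [hkq5]) hr10
    have key : (53 + 3 * ((Neg.Kq κ : ℕ) : ℤ)) * (((fcellsA κ Φ t p D g f).r 1 : ℕ) : ℤ) + 40 * ((Neg.Kq κ : ℕ) : ℤ) ≤ 200 * ((Neg.Kq κ : ℕ) : ℤ) * (((fcellsA κ Φ t p D g f).r 1 : ℕ) : ℤ) := by linarith only [hA, hr1, hkq5]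
    have h6 := mul_le_mul_of_nonneg_right key hm.le
    have h7 : (((fcellsA κ Φ t p D g f).r 1 : ℕ) : ℤ) * (-((53 + 3 * ((Neg.Kq κ : ℕ) : ℤ)) * (modulus (nL κ Φ t p D g f) (hL κ Φ t p D g f) (vL κ Φ t p D g f) (vβL κ Φ t p D g f)))) ≤ (((fcellsA κ Φ t p D g f).r 1 : ℕ) : ℤ) * ((((shearUnit (nL κ Φ t p D g f) (hL κ Φ t p D g f) : ℕ)) : ℤ) * ((k : ℤ) * (((nL κ Φ t p D g f : ℤ) * ℓL κ Φ t p D g f - (shearUnit (nL κ Φ t p D g f) (hL κ Φ t p D g f) : ℕ) + 1) / (shearUnit (nL κ Φ t p D g f) (hL κ Φ t p D g f) : ℕ)) - (((kgqY κ Φ t p D g f qxY : ℕ) : ℤ) + (((kgNYv0 κ Φ t p D g f mk qxY WxY : ℕ) : ℤ) + 1) * (kgR κ Φ t p D mk) + (((kgM₁Y (nL κ Φ t p D g f) (vL κ Φ t p D g f) (kgR κ Φ t p D mk) 0 (kgWY κ Φ t p D g f (KS.WxYR κ Φ t p D mk g f WxY)) (kgNYv0 κ Φ t p D g f mk qxY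 WxY) : ℕ) : ℤ) + 1) * ((kgR κ Φ t p D mk) + ((0 : ℕ) : ℤ)) + ((nL κ Φ t p D g f : ℤ) * ℓL κ Φ t p D g f / (shearUnit (nL κ Φ t p D g f) (hL κ Φ t p D g f) : ℕ) + 1) + (kgR κ Φ t p D mk) + ((3 * (nL κ Φ t p D g f * ℓL κ Φ t p D g f) / shearUnit (nL κ Φ t p D g f) (hL κ Φ t p D g f) + 1 : ℕ) : ℤ)) + 0)) := mul_le_mul_of_nonneg_left h5 hr10
    linarith only [h7, h6]
  exact rootFootT_snd_of_bounds (fcellsT κ Φ t p D g f c) (by rw [fcellsT_r]; linarith only [hrd1.1, hX1]) (by rw [fcellsT_r]; linarith only [hrd1.2, hY1])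
    (by rw [fcellsT_r]; linarith only [hrd0.1, hX0]) (by rw [fcellsT_r]; linarith only [hrd0.2, hY0]) (one_le_r_fst κ Φ t p D g f c hN)

end ReadYk

end KS

end NegB

end PlanarSkeletonFrm

end Summit.CriticalPhenomena.PercolationContinuityZ3.Theorems.Transplant

end
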